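import Literature.RepresentationTheory.FiniteGroups.KLRGradedCellularBasisMurphyBasis
import HarnessLib

/-!
# Jucys–Murphy elements against Murphy's basis (Hu–Mathas 2010, §3.3 / §4.3 at level one)

Continuation of `KLRGradedCellularBasisMurphyBasis`: the interaction of the Jucys–Murphy elements
`L_k = ∑_{j<k} (j k)` (`jucysMurphy`, file `KLRGradedCellularBasisProofs`) with the Young subgroup
sums `x_Q` and Murphy's `x_λ`, modulo the dominance ideals `J^{▷λ}` (`domIdeal`), over an
arbitrary commutative ring `R`:

* **coset expansions** (`blockSum_update_eq_mul`, `blockSum_update_eq_mul'`): merging a singleton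
  entry `m` into the block `b` of `Q` gives `x_{Q[m ↦ b]} = x_Q (1 + ∑_{j ∈ b} (j m)) =
  (1 + ∑_{j ∈ b} (j m)) x_Q`;
* **the base case of the Jucys–Murphy triangularity** (`murphyX_mul_jucysMurphy_sub_smul_mem`):
  `x_λ L_k ≡ (c - r) x_λ (mod J^{▷λ})` for the entry `k` in row `r` and column `c` of `𝔱^λ`
  (Hu–Mathas (3.7) for `𝔰 = 𝔱 = 𝔱^λ`; Murphy, Dipper–James);
* **the product formula** (`jmProd_sub_murphyX_mem_domIdeal`):
  `∏_{k} (L_k + r_k + 1) ≡ x_λ (mod J^{▷λ})`, `r_k` the row of `k` in `𝔱^λ` — an integral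
  substitute, at level one, for Hu–Mathas' computation of `e_λ y_λ` through seminormal forms
  (their Lemma 39, Theorem 40 and Corollary 42): in `𝔽_p S_n` it yields `e_λ y_λ ≡ c_λ x_λ` with
  `c_λ ≠ 0` directly;
* **the KLR idempotents as polynomials in the Jucys–Murphy elements** (`weightElt_eq_klrIdempotent`:
  `e(𝐢) = ∏_r P_r(L_r)` for CRT polynomials `P_r`, Hu–Mathas §4.1), `e(𝐢)* = e(𝐢)`
  (`grpAlgStar_klrIdempotent`), and the **weight congruence lemmas** (`mul_klrIdempotent_sub_mem`,
  `mul_klrIdempotent_mem_of_ne`, `klrIdempotent_mul_congr`): if `x L_r ≡ i_r x` modulo a subspace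
  `N` stable under the `L_r`, then `x e(𝐢) ≡ x` and `x e(𝐣) ≡ 0 (mod N)`.

## References

* J. Hu, A. Mathas, *Graded cellular bases for the cyclotomic Khovanov–Lauda–Rouquier algebras of
  type A*, Adv. Math. 225 (2010), arXiv:0907.2985, §3.3 (3.7) and §4.3. [HuMathas2010]
-/

noncomputable section

open scoped BigOperators

namespace Literature.RepresentationTheory.FiniteGroups

open Equiv Literature.NumberTheory.DiophantineGeometry

variable (R : Type*) [CommRing R] {n : ℕ}

/-! ### Relabelling one entry: block sizes -/

section Update

variable {n : ℕ}

/-- The blocks of `Q[m ↦ c]`. [folklore] -/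
theorem update_apply_eq_iff (Q : Fin n → ℕ) (m : Fin n) (c b : ℕ) (e : Fin n) :
    Function.update Q m c e = b ↔ (e = m ∧ c = b) ∨ (e ≠ m ∧ Q e = b) := by
  by_cases he : e = m
  · subst he; simp [Function.update_self]
  · simp [he]

/-- Merging the entry `m` into the block `c` enlarges that block by one … [folklore] -/
theorem blockSize_update_new (Q : Fin n → ℕ) (m : Fin n) {c : ℕ} (hc : c ≠ Q m) :
    blockSize (Function.update Q m c) c = blockSize Q c + 1 := by
  classical
  unfold blockSize
  rw [show (Finset.univ.filter fun i => Function.update Q m c i = c) = insert m (Finset.univ.filter fun i => Q i = c) by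
    ext e
    simp only [Finset.mem_filter, Finset.mem_insert, Finset.mem_univ, true_and]
    by_cases he : e = m
    · subst he; simp [Function.update_self]
    · simp [he]]
  rw [Finset.card_insert_of_notMem]
  simpa using hc.symm

/-- … shrinks the old block of `m` by one … [folklore] -/
theorem blockSize_update_old (Q : Fin n → ℕ) (m : Fin n) {c : ℕ} (hc : c ≠ Q m) :
    blockSize (Function.update Q m c) (Q m) = blockSize Q (Q m) - 1 := by
  classical
  unfold blockSize
  rw [show (Finset.univ.filter fun i => Function.update Q m c i = Q m) = (Finset.univ.filter fun i => Q i = Q m).erase m by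
    ext e
    simp only [Finset.mem_filter, Finset.mem_erase, Finset.mem_univ, true_and]
    by_cases he : e = m
    · subst he; simp [Function.update_self, hc]
    · simp [he]]
  rw [Finset.card_erase_of_mem]
  simp

/-- … and leaves the other blocks unchanged. [folklore] -/
theorem blockSize_update_of_ne (Q : Fin n → ℕ) (m : Fin n) {c b : ℕ} (hbc : b ≠ c) (hbm : b ≠ Q m) :
    blockSize (Function.update Q m c) b = blockSize Q b := by
  classical
  unfold blockSize
  congr 1
  ext e
  simp only [Finset.mem_filter, Finset.mem_univ, true_and]
  by_cases he : e = m
  · subst he; simp [Function.update_self, hbc.symm, hbm.symm]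
  · simp [Function.update_of_ne he]

/-- If `m` is alone in its block, every permutation preserving the blocks of `Q` preserves those of
`Q[m ↦ c]`. [folklore] -/
theorem blockStab_le_blockStab_update {Q : Fin n → ℕ} {m : Fin n} (hm : ∀ e, Q e = Q m → e = m) (c : ℕ) :
    blockStab Q ≤ blockStab (Function.update Q m c) := by
  intro σ hσ
  rw [mem_blockStab_iff] at hσ ⊢
  have hσm : σ m = m := hm _ (hσ m)
  intro i
  by_cases hi : i = m
  · rw [hi, hσm]
  · have hσi : σ i ≠ m := fun h => hi (σ.injective (h.trans hσm.symm))
    rw [Function.update_of_ne hσi, Function.update_of_ne hi, hσ]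

end Update

/-! ### Coset expansions: `x_{Q[m ↦ b]} = x_Q (1 + ∑_{j ∈ b} (j m))` -/

section Coset

variable {n : ℕ}

open scoped Classical in
/-- **Coset expansion.** If the entry `m` is alone in its block of `Q` and `c ≠ Q m`, then
`x_{Q[m ↦ c]} = x_Q · (1 + ∑_{j : Q j = c} (j m))`: the Young subgroup of `Q[m ↦ c]` is the
disjoint union of the translates `S_Q · (j m)` over `j` in the enlarged block. [folklore] -/
theorem blockSum_update_eq_mul (Q : Fin n → ℕ) (m : Fin n) (hm : ∀ e, Q e = Q m → e = m) {c : ℕ} (hc : c ≠ Q m) :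
    blockSum R (Function.update Q m c) =
      blockSum R Q * (1 + ∑ j ∈ Finset.univ.filter (fun j => Q j = c), MonoidAlgebra.of R _ (swap j m)) := by
  set Q' := Function.update Q m c with hQ'
  have hQ'm : Q' m = c := Function.update_self _ _ _
  have hQ'e : ∀ e, e ≠ m → Q' e = Q e := fun e he => Function.update_of_ne he _ _
  -- the transpositions of the enlarged block preserve `Q'`
  have hQ'j : ∀ j, (j = m ∨ Q j = c) → Q' j = c := by
    rintro j (rfl | hj)
    · exact hQ'm
    · by_cases hjm : j = m
      · rw [hjm, hQ'm]
      · rw [hQ'e j hjm, hj]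
  have hswap : ∀ j, (j = m ∨ Q j = c) → swap j m ∈ blockStab Q' := by
    intro j hj
    rw [mem_blockStab_iff]
    intro i
    rcases eq_or_ne i j with rfl | hij
    · rw [swap_apply_left, hQ'm, hQ'j i hj]
    rcases eq_or_ne i m with rfl | him
    · rw [swap_apply_right, hQ'j j hj, hQ'm]
    · rw [swap_apply_of_ne_of_ne hij him]
  have hsub : ∀ σ ∈ blockStab Q, σ ∈ blockStab Q' := fun σ hσ => blockStab_le_blockStab_update hm c hσ
  have hfix : ∀ σ ∈ blockStab Q, σ m = m := fun σ hσ => hm _ ((mem_blockStab_iff _ _).1 hσ m)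
  -- the decomposition `τ = σ · (j m)` with `j = τ⁻¹ m`
  have hback : ∀ τ ∈ blockStab Q', τ * swap (τ⁻¹ m) m ∈ blockStab Q ∧ (τ⁻¹ m = m ∨ Q (τ⁻¹ m) = c) := by
    intro τ hτ
    have hj : τ⁻¹ m = m ∨ Q (τ⁻¹ m) = c := by
      by_cases h : τ⁻¹ m = m
      · exact Or.inl h
      · right
        have := (mem_blockStab_iff _ _).1 (inv_mem hτ) m
        rwa [hQ'm, hQ'e _ h] at this
    refine ⟨?_, hj⟩
    have hprod : τ * swap (τ⁻¹ m) m ∈ blockStab Q' := mul_mem hτ (hswap _ hj)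
    have hfixm : (τ * swap (τ⁻¹ m) m) m = m := by
      rw [Perm.mul_apply, swap_apply_right]
      simp only [Perm.inv_def, Equiv.apply_symm_apply]
    rw [mem_blockStab_iff] at hprod ⊢
    intro i
    by_cases hi : i = m
    · rw [hi, hfixm]
    · have h1 := hprod i
      have hne : (τ * swap (τ⁻¹ m) m) i ≠ m := fun h => hi ((τ * swap (τ⁻¹ m) m).injective (h.trans hfixm.symm))
      rwa [hQ'e _ hne, hQ'e _ hi] at h1
  have hmnot : m ∉ Finset.univ.filter (fun j => Q j = c) := by simpa using fun h => hc h.symm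
  -- both sides as a sum over pairs `(σ, j)`
  have rhs : blockSum R Q * (1 + ∑ j ∈ Finset.univ.filter (fun j => Q j = c), MonoidAlgebra.of R _ (swap j m)) =
      ∑ p ∈ (Finset.univ.filter fun σ : Perm (Fin n) => σ ∈ blockStab Q) ×ˢ insert m (Finset.univ.filter fun j => Q j = c),
        MonoidAlgebra.of R _ (p.1 * swap p.2 m) := by
    rw [Finset.sum_product, blockSum, Finset.sum_mul]
    refine Finset.sum_congr rfl fun σ _ => ?_
    rw [Finset.sum_insert hmnot, swap_self, show (Equiv.refl (Fin n) : Perm (Fin n)) = 1 from rfl, mul_one, mul_add, mul_one,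
      Finset.mul_sum]
    simp_rw [← map_mul]
  rw [rhs, blockSum]
  symm
  refine Finset.sum_bij' (fun p _ => p.1 * swap p.2 m) (fun τ _ => (τ * swap (τ⁻¹ m) m, τ⁻¹ m)) (fun p hp => ?_) (fun τ hτ => ?_)
    (fun p hp => ?_) (fun τ _ => ?_) (fun p _ => rfl)
  · rw [Finset.mem_product, Finset.mem_filter, Finset.mem_insert, Finset.mem_filter] at hp
    rw [Finset.mem_filter]
    refine ⟨Finset.mem_univ _, mul_mem (hsub _ hp.1.2) (hswap _ ?_)⟩
    exact hp.2.imp id And.right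
  · rw [Finset.mem_filter] at hτ
    obtain ⟨h1, h2⟩ := hback τ hτ.2
    rw [Finset.mem_product, Finset.mem_filter, Finset.mem_insert, Finset.mem_filter]
    exact ⟨⟨Finset.mem_univ _, h1⟩, h2.imp id fun h => ⟨Finset.mem_univ _, h⟩⟩
  · rw [Finset.mem_product, Finset.mem_filter] at hp
    have hσm : p.1⁻¹ m = m := by
      have := hfix _ hp.1.2
      rw [Perm.inv_def, Equiv.symm_apply_eq]; exact this.symm
    have hj : (p.1 * swap p.2 m)⁻¹ m = p.2 := by
      rw [mul_inv_rev, swap_inv, Perm.mul_apply, hσm, swap_apply_right]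
    rw [hj, Equiv.mul_swap_mul_self]
  · simp only [Equiv.mul_swap_mul_self]

/-- `1* = 1`. [folklore] -/
theorem grpAlgStar_one : grpAlgStar R (1 : MonoidAlgebra R (Perm (Fin n))) = 1 := by
  rw [show (1 : MonoidAlgebra R (Perm (Fin n))) = MonoidAlgebra.of R _ 1 from (map_one _).symm, grpAlgStar_of, inv_one]

open scoped Classical in
/-- **Coset expansion, mirrored**: `x_{Q[m ↦ c]} = (1 + ∑_{j : Q j = c} (j m)) · x_Q`. [folklore] -/
theorem blockSum_update_eq_mul' (Q : Fin n → ℕ) (m : Fin n) (hm : ∀ e, Q e = Q m → e = m) {c : ℕ} (hc : c ≠ Q m) :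
    blockSum R (Function.update Q m c) =
      (1 + ∑ j ∈ Finset.univ.filter (fun j => Q j = c), MonoidAlgebra.of R _ (swap j m)) * blockSum R Q := by
  have key := congrArg (grpAlgStar R) (blockSum_update_eq_mul R Q m hm hc)
  rw [grpAlgStar_blockSum, grpAlgStar_mul, grpAlgStar_blockSum, map_add, grpAlgStar_one, map_sum] at key
  rw [key]
  congr 2
  refine Finset.sum_congr rfl fun j _ => ?_
  rw [grpAlgStar_of, swap_inv]

/-- In particular `x_Q · ∑_{j : Q j = c} (j m) = x_{Q[m ↦ c]} - x_Q`. [folklore] -/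
theorem blockSum_mul_sum_swap (Q : Fin n → ℕ) (m : Fin n) (hm : ∀ e, Q e = Q m → e = m) {c : ℕ} (hc : c ≠ Q m) :
    blockSum R Q * ∑ j ∈ Finset.univ.filter (fun j => Q j = c), MonoidAlgebra.of R _ (swap j m) =
      blockSum R (Function.update Q m c) - blockSum R Q := by
  rw [blockSum_update_eq_mul R Q m hm hc, mul_add, mul_one, add_sub_cancel_left]

end Coset


/-! ### Rows and columns of `𝔱^λ` -/

section RowCol

variable {n : ℕ} (μ : Nat.Partition n)

/-- `rowOf` is monotone in the entry. [folklore] -/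
theorem rowOf_mono {j k : Fin n} (h : j ≤ k) : μ.rowOf j ≤ μ.rowOf k :=
  row_monotone_of_rowInv_eq_zero (rowReading μ).1 (rowInv_rowReading μ) h

/-- An entry of a strictly earlier row is smaller. [folklore] -/
theorem lt_of_rowOf_lt {j k : Fin n} (h : μ.rowOf j < μ.rowOf k) : j < k :=
  lt_of_not_ge fun hle => absurd (rowOf_mono μ hle) (not_le.2 h)

/-- The rows are `< n`. [folklore] -/
theorem rowOf_lt (e : Fin n) : μ.rowOf e < n := by
  have := rowFunOf_lt μ 1 e
  rwa [rowFunOf_apply, inv_one, Perm.one_apply] at this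

/-- An entry lies in row `r` iff it lies in the interval `[μ₁ + ⋯ + μ_r, μ₁ + ⋯ + μ_{r+1})`; in
particular the entries `j` of the row of `k` are those with `μ₁ + ⋯ + μ_r ≤ j`, `j` before the end
of the row. [folklore] -/
theorem rowOf_eq_iff_of_lt (k j : Fin n) (hjk : j < k) :
    μ.rowOf j = μ.rowOf k ↔ (μ.sortedParts.take (μ.rowOf k)).sum ≤ j := by
  constructor
  · intro h; rw [← h]; exact μ.sum_take_rowOf_le j
  · intro h
    refine le_antisymm (rowOf_mono μ hjk.le) ?_
    rcases Nat.eq_zero_or_pos (μ.rowOf k) with h0 | hpos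
    · rw [h0]; exact Nat.zero_le _
    · have key := (μ.sum_take_succ_le_iff_lt_rowOf j (r := μ.rowOf k - 1) (by have := μ.rowOf_lt_length k; omega)).1
        (by rwa [Nat.sub_add_cancel hpos])
      omega

/-- **The entries of the row of `k` before `k` number `colOf k`.** [folklore] -/
theorem card_filter_lt_rowOf_eq_colOf (k : Fin n) :
    (Finset.univ.filter fun j : Fin n => j < k ∧ μ.rowOf j = μ.rowOf k).card = μ.colOf k := by
  set S := (μ.sortedParts.take (μ.rowOf k)).sum with hS
  have hk := μ.val_eq_sum_take_rowOf_add_colOf k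
  have hset : (Finset.univ.filter fun j : Fin n => j < k ∧ μ.rowOf j = μ.rowOf k).map Fin.valEmbedding = Finset.Ico S k := by
    ext x
    rw [Finset.mem_map, Finset.mem_Ico]
    constructor
    · rintro ⟨j, hj, rfl⟩
      rw [Finset.mem_filter] at hj
      exact ⟨(rowOf_eq_iff_of_lt μ k j hj.2.1).1 hj.2.2, Fin.lt_def.1 hj.2.1⟩
    · rintro ⟨h1, h2⟩
      refine ⟨⟨x, h2.trans k.2⟩, Finset.mem_filter.2 ⟨Finset.mem_univ _, ?_, ?_⟩, rfl⟩
      · exact Fin.lt_def.2 h2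
      · exact (rowOf_eq_iff_of_lt μ k _ (Fin.lt_def.2 h2)).2 h1
  rw [← Finset.card_map Fin.valEmbedding, hset, Nat.card_Ico]
  omega

/-- A transposition of two entries of the same row lies in `S_λ`. [folklore] -/
theorem swap_mem_rowStabilizer {j k : Fin n} (h : μ.rowOf j = μ.rowOf k) : swap j k ∈ rowStabilizer μ := by
  rw [mem_rowStabilizer_iff]
  intro i
  rcases eq_or_ne i j with rfl | hij
  · rw [swap_apply_left, h]
  rcases eq_or_ne i k with rfl | hik
  · rw [swap_apply_right, h]
  · rw [swap_apply_of_ne_of_ne hij hik]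

end RowCol

/-! ### The base case of the Jucys–Murphy triangularity: `x_λ L_k ≡ (c - r) x_λ (mod J^{▷λ})` -/

section BaseJM

variable {n : ℕ} (μ : Nat.Partition n)

/-- `rowOf` with the entry `k` made a singleton (fresh label `n`). [folklore] -/
def rowOfBut (k : Fin n) : Fin n → ℕ := Function.update μ.rowOf k n

/-- `k` is alone in its block of `rowOfBut k`. [folklore] -/
theorem rowOfBut_eq_iff (k e : Fin n) : rowOfBut μ k e = rowOfBut μ k k → e = k := by
  intro h
  by_contra hne
  rw [rowOfBut, Function.update_self, Function.update_of_ne hne] at h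
  exact absurd h (ne_of_lt (rowOf_lt μ e))

/-- The value at `k`. [folklore] -/
theorem rowOfBut_self (k : Fin n) : rowOfBut μ k k = n := Function.update_self _ _ _

/-- The values elsewhere. [folklore] -/
theorem rowOfBut_of_ne {k e : Fin n} (h : e ≠ k) : rowOfBut μ k e = μ.rowOf e := Function.update_of_ne h _ _

/-- Relabelling `k` back gives `rowOf`. [folklore] -/
theorem update_rowOfBut (k : Fin n) : Function.update (rowOfBut μ k) k (μ.rowOf k) = μ.rowOf := by
  rw [rowOfBut, Function.update_idem, Function.update_eq_self]

open scoped Classical in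
/-- `x_λ = (1 + ∑_{j ∈ row(k) ∖ k} (j k)) · x_{λ ∖ k}`. [folklore] -/
theorem murphyX_eq_mul_blockSum_rowOfBut (k : Fin n) :
    murphyX R μ = (1 + ∑ j ∈ Finset.univ.filter (fun j => rowOfBut μ k j = μ.rowOf k), MonoidAlgebra.of R _ (swap j k)) *
      blockSum R (rowOfBut μ k) := by
  conv_lhs => rw [murphyX_eq_blockSum, ← update_rowOfBut μ k]
  refine blockSum_update_eq_mul' R (rowOfBut μ k) k (rowOfBut_eq_iff μ k) ?_
  rw [rowOfBut_self]; exact ne_of_lt (rowOf_lt μ k)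

/-- Moving the entry `k` from its row `r` up to a row `i < r` is a strict dominance move. [folklore] -/
theorem labSDom_update_rowOf {k : Fin n} {i : ℕ} (hi : i < μ.rowOf k) : LabSDom (Function.update μ.rowOf k i) μ.rowOf := by
  have hir : i ≠ μ.rowOf k := ne_of_lt hi
  have hk : 1 ≤ blockSize μ.rowOf (μ.rowOf k) :=
    Finset.card_pos.2 ⟨k, Finset.mem_filter.2 ⟨Finset.mem_univ _, rfl⟩⟩
  refine labSDom_of_move (blk := μ.rowOf) (b₁ := i) (b₂ := μ.rowOf k) hir (m := 1) le_rfl hk ?_ ?_ ?_ fun b hb1 hb2 => ?_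
  · rw [blockSize_rowOf, blockSize_rowOf]
    exact μ.youngDiagram.rowLen_anti i (μ.rowOf k) hi.le
  · exact blockSize_update_new μ.rowOf k hir
  · exact blockSize_update_old μ.rowOf k hir
  · exact blockSize_update_of_ne μ.rowOf k hb1 hb2

open scoped Classical in
/-- **The base case of the Jucys–Murphy triangularity** (Hu–Mathas (3.7) for `𝔰 = 𝔱 = 𝔱^λ`;
Murphy, Dipper–James): for the entry `k` in row `r` and column `c` of `𝔱^λ` (0-based),
`x_λ L_k ≡ (c - r) · x_λ (mod J^{▷λ})`. Proof: split `L_k = ∑_{j<k} (j k)` by the rows of `j`;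
the `c` transpositions inside row `r` fix `x_λ`; for a row `i < r`,
`x_λ ∑_{j ∈ row i} (j k) = P · (x_{Q_i} - x_{λ∖k}) = P x_{Q_i} - x_λ` with `Q_i = 𝔱^λ` with `k`
moved up to row `i`, a strictly more dominant labelling, so `x_{Q_i} ∈ J^{▷λ}`.
[cite: HuMathas2010, §3.3 (3.7)] -/
theorem murphyX_mul_jucysMurphy_sub_smul_mem (k : Fin n) :
    murphyX R μ * jucysMurphy R k - ((μ.colOf k : R) - (μ.rowOf k : R)) • murphyX R μ ∈ domIdeal R μ.rowOf := by
  set r := μ.rowOf k with hr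
  -- split `L_k` by rows
  have hsplit : jucysMurphy R k =
      ∑ i ∈ Finset.range r, ∑ j ∈ Finset.univ.filter (fun j : Fin n => μ.rowOf j = i), MonoidAlgebra.of R _ (swap j k) +
        ∑ j ∈ Finset.univ.filter (fun j : Fin n => j < k ∧ μ.rowOf j = r), MonoidAlgebra.of R _ (swap j k) := by
    rw [jucysMurphy, ← Finset.sum_fiberwise_of_maps_to (s := Finset.univ.filter fun j : Fin n => j < k)
      (t := Finset.range (r + 1)) (g := μ.rowOf) (fun j hj => Finset.mem_range.2 (Nat.lt_succ_of_le
        (rowOf_mono μ (Finset.mem_filter.1 hj).2.le))), Finset.sum_range_succ]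
    congr 1
    · refine Finset.sum_congr rfl fun i hi => Finset.sum_congr ?_ fun _ _ => rfl
      rw [Finset.mem_range] at hi
      ext j
      simp only [Finset.mem_filter, Finset.mem_univ, true_and, and_iff_right_iff_imp]
      intro hj
      exact lt_of_rowOf_lt μ (by rw [hj]; exact hi)
    · refine Finset.sum_congr ?_ fun _ _ => rfl
      ext j
      simp only [Finset.mem_filter, Finset.mem_univ, true_and]
  -- the transpositions inside row `r`
  have hrow : murphyX R μ * ∑ j ∈ Finset.univ.filter (fun j : Fin n => j < k ∧ μ.rowOf j = r), MonoidAlgebra.of R _ (swap j k) =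
      (μ.colOf k : R) • murphyX R μ := by
    rw [Finset.mul_sum, Finset.sum_congr rfl (fun j hj => murphyX_mul_of R (swap_mem_rowStabilizer μ (Finset.mem_filter.1 hj).2.2)),
      Finset.sum_const, card_filter_lt_rowOf_eq_colOf, ← Nat.cast_smul_eq_nsmul R]
  -- the rows above
  set P := (1 + ∑ j ∈ Finset.univ.filter (fun j => rowOfBut μ k j = μ.rowOf k), MonoidAlgebra.of R _ (swap j k)) with hP
  have hup : ∀ i < r, murphyX R μ * ∑ j ∈ Finset.univ.filter (fun j : Fin n => μ.rowOf j = i), MonoidAlgebra.of R _ (swap j k) =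
      P * blockSum R (Function.update (rowOfBut μ k) k i) - murphyX R μ := by
    intro i hi
    have hfilter : (Finset.univ.filter fun j : Fin n => μ.rowOf j = i) = Finset.univ.filter fun j => rowOfBut μ k j = i := by
      ext j
      simp only [Finset.mem_filter, Finset.mem_univ, true_and]
      by_cases hj : j = k
      · rw [hj, rowOfBut_self]
        exact ⟨fun h => absurd h (ne_of_gt hi), fun h => absurd h (ne_of_gt ((rowOf_lt μ k).trans_le' hi.le))⟩
      · rw [rowOfBut_of_ne μ hj]
    rw [hfilter, murphyX_eq_mul_blockSum_rowOfBut R μ k, mul_assoc, blockSum_mul_sum_swap R (rowOfBut μ k) k (rowOfBut_eq_iff μ k)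
      (by rw [rowOfBut_self]; exact ne_of_lt ((rowOf_lt μ k).trans_le' hi.le)), mul_sub]
  -- assemble
  have key : murphyX R μ * jucysMurphy R k - ((μ.colOf k : R) - (μ.rowOf k : R)) • murphyX R μ =
      ∑ i ∈ Finset.range r, P * blockSum R (Function.update (rowOfBut μ k) k i) := by
    rw [hsplit, mul_add, hrow, Finset.mul_sum, Finset.sum_congr rfl (fun i hi => hup i (Finset.mem_range.1 hi)), Finset.sum_sub_distrib,
      Finset.sum_const, Finset.card_range, sub_smul, ← hr, ← Nat.cast_smul_eq_nsmul R]
    abel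
  rw [key]
  refine Submodule.sum_mem _ fun i hi => mul_mem_domIdeal_left R P (blockSum_mem_domIdeal R ?_)
  -- `Q_i ▷ λ`
  rw [rowOfBut, Function.update_idem]
  exact labSDom_update_rowOf μ (Finset.mem_range.1 hi)

end BaseJM


/-! ### Column counts of the first `m` entries -/

section PCount

variable {n : ℕ}

/-- The number of entries `< m` in the block `c`. [folklore] -/
def pbs (Q : Fin n → ℕ) (m c : ℕ) : ℕ := (Finset.univ.filter fun j : Fin n => (j : ℕ) < m ∧ Q j = c).card

/-- The labels of the entries `< m`. [folklore] -/
def plabels (Q : Fin n → ℕ) (m : ℕ) : Finset ℕ := (Finset.univ.filter fun j : Fin n => (j : ℕ) < m).image Q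

/-- **The column counts of the first `m` entries**: `∑_{blocks} min(#entries < m in the block, t)`.
[folklore] -/
def pcount (Q : Fin n → ℕ) (m t : ℕ) : ℕ := ∑ c ∈ plabels Q m, min (pbs Q m c) t

/-- Membership in `plabels`. [folklore] -/
theorem mem_plabels {Q : Fin n → ℕ} {m c : ℕ} : c ∈ plabels Q m ↔ ∃ j : Fin n, (j : ℕ) < m ∧ Q j = c := by
  simp [plabels]

/-- Used labels have entries. [folklore] -/
theorem pbs_pos_of_mem {Q : Fin n → ℕ} {m c : ℕ} (hc : c ∈ plabels Q m) : 0 < pbs Q m c := by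
  obtain ⟨j, hj, hjc⟩ := mem_plabels.1 hc
  exact Finset.card_pos.2 ⟨j, Finset.mem_filter.2 ⟨Finset.mem_univ _, hj, hjc⟩⟩

/-- Unused labels have no entries. [folklore] -/
theorem pbs_eq_zero_of_not_mem {Q : Fin n → ℕ} {m c : ℕ} (hc : c ∉ plabels Q m) : pbs Q m c = 0 := by
  rw [pbs, Finset.card_eq_zero, Finset.filter_eq_empty_iff]
  rintro j - ⟨hj, hjc⟩
  exact hc (mem_plabels.2 ⟨j, hj, hjc⟩)

/-- The count may be summed over any set of labels containing the used ones. [folklore] -/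
theorem pcount_eq_sum_of_subset (Q : Fin n → ℕ) (m : ℕ) {S : Finset ℕ} (hS : plabels Q m ⊆ S) (t : ℕ) :
    pcount Q m t = ∑ c ∈ S, min (pbs Q m c) t := by
  rw [pcount]
  refine Finset.sum_subset hS fun c _ hc => ?_
  rw [pbs_eq_zero_of_not_mem hc, Nat.zero_min]

/-- The counts only depend on the labels of the entries `< m`. [folklore] -/
theorem pbs_congr {Q Q' : Fin n → ℕ} {m : ℕ} (h : ∀ j : Fin n, (j : ℕ) < m → Q j = Q' j) (c : ℕ) : pbs Q m c = pbs Q' m c := by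
  unfold pbs
  congr 1
  ext j
  simp only [Finset.mem_filter, Finset.mem_univ, true_and]
  exact ⟨fun hj => ⟨hj.1, (h j hj.1) ▸ hj.2⟩, fun hj => ⟨hj.1, (h j hj.1).symm ▸ hj.2⟩⟩

/-- The labels only depend on the labels of the entries `< m`. [folklore] -/
theorem plabels_congr {Q Q' : Fin n → ℕ} {m : ℕ} (h : ∀ j : Fin n, (j : ℕ) < m → Q j = Q' j) : plabels Q m = plabels Q' m := by
  ext c
  rw [mem_plabels, mem_plabels]
  exact ⟨fun ⟨j, hj, hjc⟩ => ⟨j, hj, (h j hj) ▸ hjc⟩, fun ⟨j, hj, hjc⟩ => ⟨j, hj, (h j hj).symm ▸ hjc⟩⟩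

/-- The column counts only depend on the labels of the entries `< m`. [folklore] -/
theorem pcount_congr {Q Q' : Fin n → ℕ} {m : ℕ} (h : ∀ j : Fin n, (j : ℕ) < m → Q j = Q' j) : pcount Q m = pcount Q' m := by
  funext t
  rw [pcount, pcount, plabels_congr h]
  exact Finset.sum_congr rfl fun c _ => by rw [pbs_congr h]

/-- Adding the entry `k`: the counts per label. [folklore] -/
theorem pbs_succ (Q : Fin n → ℕ) (k : Fin n) (c : ℕ) : pbs Q (k + 1) c = pbs Q k c + if Q k = c then 1 else 0 := by
  unfold pbs
  rw [show (Finset.univ.filter fun j : Fin n => (j : ℕ) < k + 1 ∧ Q j = c) =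
      (Finset.univ.filter fun j : Fin n => (j : ℕ) < k ∧ Q j = c) ∪ (if Q k = c then {k} else ∅) by
    ext j
    simp only [Finset.mem_filter, Finset.mem_univ, true_and, Finset.mem_union]
    constructor
    · rintro ⟨h1, h2⟩
      rcases Nat.lt_succ_iff_lt_or_eq.1 h1 with h | h
      · exact Or.inl ⟨h, h2⟩
      · right
        have : j = k := Fin.ext h
        subst this
        rw [if_pos h2]; exact Finset.mem_singleton_self _
    · rintro (⟨h1, h2⟩ | h)
      · exact ⟨Nat.lt_succ_of_lt h1, h2⟩
      · split_ifs at h with hc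
        · rw [Finset.mem_singleton] at h; subst h; exact ⟨Nat.lt_succ_self _, hc⟩
        · exact absurd h (Finset.notMem_empty _)]
  rw [Finset.card_union_of_disjoint]
  · split_ifs <;> simp
  · rw [Finset.disjoint_left]
    intro j hj hj'
    rw [Finset.mem_filter] at hj
    split_ifs at hj' with hc
    · rw [Finset.mem_singleton] at hj'; subst hj'; exact lt_irrefl _ hj.2.1
    · exact absurd hj' (Finset.notMem_empty _)

/-- Adding the entry `k`: the labels. [folklore] -/
theorem plabels_succ (Q : Fin n → ℕ) (k : Fin n) : plabels Q (k + 1) = insert (Q k) (plabels Q k) := by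
  ext c
  rw [mem_plabels, Finset.mem_insert, mem_plabels]
  constructor
  · rintro ⟨j, hj, hjc⟩
    rcases Nat.lt_succ_iff_lt_or_eq.1 hj with h | h
    · exact Or.inr ⟨j, h, hjc⟩
    · left; rw [← hjc]; congr 1; exact Fin.ext h
  · rintro (rfl | ⟨j, hj, hjc⟩)
    · exact ⟨k, Nat.lt_succ_self _, rfl⟩
    · exact ⟨j, Nat.lt_succ_of_lt hj, hjc⟩

/-- **Adding the entry `k` to the count**: the block of `k` goes from `s` to `s + 1` entries,
`C_t(≤ k) + min(s, t) = C_t(< k) + min(s + 1, t)`. [folklore] -/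
theorem pcount_succ (Q : Fin n → ℕ) (k : Fin n) (t : ℕ) :
    pcount Q (k + 1) t + min (pbs Q k (Q k)) t = pcount Q k t + min (pbs Q k (Q k) + 1) t := by
  classical
  have hS : plabels Q k ⊆ insert (Q k) (plabels Q k) := Finset.subset_insert _ _
  rw [pcount_eq_sum_of_subset Q (k + 1) (by rw [plabels_succ]) t, pcount_eq_sum_of_subset Q k hS t,
    ← Finset.add_sum_erase _ _ (Finset.mem_insert_self (Q k) _), ← Finset.add_sum_erase _ _ (Finset.mem_insert_self (Q k) _),
    pbs_succ, if_pos rfl,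
    Finset.sum_congr rfl (fun c hc => by
      rw [Finset.mem_erase] at hc
      rw [pbs_succ, if_neg (Ne.symm hc.1), add_zero] : ∀ c ∈ (insert (Q k) (plabels Q k)).erase (Q k),
        min (pbs Q (k + 1) c) t = min (pbs Q k c) t)]
  ring

/-- At `m = n` the counts are the block sizes … [folklore] -/
theorem pbs_n (Q : Fin n → ℕ) (c : ℕ) : pbs Q n c = blockSize Q c := by
  unfold pbs blockSize
  congr 1; ext j; simp

/-- … all labels are used … [folklore] -/
theorem plabels_n (Q : Fin n → ℕ) : plabels Q n = Finset.univ.image Q := by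
  unfold plabels
  congr 1; ext j; simp

/-- … and the counts are the column counts. [folklore] -/
theorem pcount_n (Q : Fin n → ℕ) : pcount Q n = colCount Q := by
  funext t
  rw [pcount, colCount, plabels_n]
  exact Finset.sum_congr rfl fun c _ => by rw [pbs_n]

/-- At `t = 1` the count is the number of blocks met. [folklore] -/
theorem pcount_one (Q : Fin n → ℕ) (m : ℕ) : pcount Q m 1 = (plabels Q m).card := by
  rw [pcount, Finset.card_eq_sum_ones]
  exact Finset.sum_congr rfl fun c hc => min_eq_right (pbs_pos_of_mem hc)

/-- `C_t ≤ #blocks · t`. [folklore] -/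
theorem pcount_le_card_mul (Q : Fin n → ℕ) (m t : ℕ) : pcount Q m t ≤ (plabels Q m).card * t := by
  rw [pcount]
  calc _ ≤ ∑ c ∈ plabels Q m, t := Finset.sum_le_sum fun c _ => min_le_right _ _
    _ = _ := by rw [Finset.sum_const, smul_eq_mul]

/-- `C_t ≤ (#blocks - 1) · t + min(s_c, t)` for a met block `c`. [folklore] -/
theorem pcount_add_le_of_mem (Q : Fin n → ℕ) (m t : ℕ) {c : ℕ} (hc : c ∈ plabels Q m) :
    pcount Q m t + t ≤ (plabels Q m).card * t + min (pbs Q m c) t := by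
  rw [pcount, ← Finset.add_sum_erase _ _ hc, Finset.card_eq_sum_ones, ← Finset.add_sum_erase _ _ hc, add_mul, one_mul,
    Finset.sum_mul]
  have : ∑ x ∈ (plabels Q m).erase c, min (pbs Q m x) t ≤ ∑ x ∈ (plabels Q m).erase c, 1 * t :=
    Finset.sum_le_sum fun x _ => by rw [one_mul]; exact min_le_right _ _
  omega

/-- The counts vanish at `t = 0`. [folklore] -/
theorem pcount_zero (Q : Fin n → ℕ) (m : ℕ) : pcount Q m 0 = 0 := by
  simp [pcount]

end PCount

/-! ### The counts of `𝔱^λ` below the entry `k` -/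

section PCountRow

variable {n : ℕ} (μ : Nat.Partition n) (k : Fin n)

/-- Row `r = row(k)` has `colOf k` entries before `k`. [folklore] -/
theorem pbs_rowOf_self : pbs μ.rowOf k (μ.rowOf k) = μ.colOf k := by
  rw [pbs, ← card_filter_lt_rowOf_eq_colOf μ k]
  rfl

/-- The rows above `row(k)` are complete before `k`. [folklore] -/
theorem pbs_rowOf_of_lt {i : ℕ} (hi : i < μ.rowOf k) : pbs μ.rowOf k i = μ.youngDiagram.rowLen i := by
  rw [pbs, ← blockSize_rowOf, blockSize]
  congr 1; ext j
  simp only [Finset.mem_filter, Finset.mem_univ, true_and, and_iff_right_iff_imp]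
  intro hj
  exact Fin.lt_def.1 (lt_of_rowOf_lt μ (by rw [hj]; exact hi))

/-- Only the rows `≤ row(k)` are met before `k`. [folklore] -/
theorem plabels_rowOf_subset : plabels μ.rowOf k ⊆ Finset.range (μ.rowOf k + 1) := by
  intro i hi
  obtain ⟨j, hj, rfl⟩ := mem_plabels.1 hi
  exact Finset.mem_range.2 (Nat.lt_succ_of_le (rowOf_mono μ (Fin.le_def.2 hj.le)))

/-- `colOf k < λ_{row k}`. [folklore] -/
theorem colOf_lt_rowLen : μ.colOf k < μ.youngDiagram.rowLen (μ.rowOf k) :=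
  YoungDiagram.mem_iff_lt_rowLen.1 (μ.rowOf_colOf_mem_youngDiagram k)

/-- **The counts of `𝔱^λ` before `k`**: `∑_{i < r} min(λ_i, t) + min(c₀, t)` with `r = row(k)`,
`c₀ = col(k)`. [folklore] -/
theorem pcount_rowOf_eq (t : ℕ) :
    pcount μ.rowOf k t = ∑ i ∈ Finset.range (μ.rowOf k), min (μ.youngDiagram.rowLen i) t + min (μ.colOf k) t := by
  rw [pcount_eq_sum_of_subset μ.rowOf k (plabels_rowOf_subset μ k) t, Finset.sum_range_succ, pbs_rowOf_self]
  congr 1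
  exact Finset.sum_congr rfl fun i hi => by rw [pbs_rowOf_of_lt μ k (Finset.mem_range.1 hi)]

/-- For `t ≤ c₀ + 1` every row above contributes `t`: `C_t = r t + min(c₀, t)`. [folklore] -/
theorem pcount_rowOf_of_le {t : ℕ} (ht : t ≤ μ.colOf k + 1) : pcount μ.rowOf k t = μ.rowOf k * t + min (μ.colOf k) t := by
  rw [pcount_rowOf_eq, Finset.sum_congr rfl (fun i hi => by
    rw [Finset.mem_range] at hi
    exact min_eq_right (ht.trans ((colOf_lt_rowLen μ k).trans_le (μ.youngDiagram.rowLen_anti i _ hi.le))) :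
      ∀ i ∈ Finset.range (μ.rowOf k), min (μ.youngDiagram.rowLen i) t = t),
    Finset.sum_const, Finset.card_range, smul_eq_mul]

end PCountRow

/-! ### Strict dominance of the first `m` entries against `𝔱^λ`, and its propagation -/

section PDom

variable {n : ℕ} (μ : Nat.Partition n)

/-- **`Q ▷ 𝔱^λ` on the first `m` entries** (column counts of the entries `< m`). [folklore] -/
def PDom (m : ℕ) (Q : Fin n → ℕ) : Prop :=
  (∀ t, pcount Q m t ≤ pcount μ.rowOf m t) ∧ ∃ t, pcount Q m t < pcount μ.rowOf m t

/-- At `m = n` this is strict dominance of the types. [folklore] -/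
theorem pdom_n_iff (Q : Fin n → ℕ) : PDom μ n Q ↔ LabSDom Q μ.rowOf := by
  unfold PDom LabSDom LabDom
  rw [pcount_n, pcount_n]

variable {μ}

/-- The number of blocks met by a dominating `Q` before `k` is at most `row(k) + 1`. [folklore] -/
theorem card_plabels_le_of_pdom {k : Fin n} {Q : Fin n → ℕ} (h : PDom μ k Q) : (plabels Q k).card ≤ μ.rowOf k + 1 := by
  have h1 := h.1 1
  rw [pcount_one, pcount_rowOf_of_le μ k (Nat.le_add_left 1 _), mul_one] at h1
  exact h1.trans (by have := min_le_right (μ.colOf k) 1; omega)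

/-- **Propagation (D2)**: if `Q ▷ 𝔱^λ` on the entries `< k` and `k` is merged into a met block `c`,
then `Q[k ↦ c] ▷ 𝔱^λ` on the entries `≤ k`. [folklore] -/
theorem pdom_succ_update {k : Fin n} {Q : Fin n → ℕ} (h : PDom μ k Q) {c : ℕ} (hc : c ∈ plabels Q k) :
    PDom μ (k + 1) (Function.update Q k c) := by
  set Q' := Function.update Q k c with hQ'
  set r := μ.rowOf k with hr
  set c₀ := μ.colOf k with hc₀
  set s := pbs Q k c with hs
  set B := (plabels Q k).card with hB
  have hagree : ∀ j : Fin n, (j : ℕ) < k → Q' j = Q j := fun j hj => Function.update_of_ne (Fin.ne_of_lt (Fin.lt_def.2 hj)) _ _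
  have hQ'k : Q' k = c := Function.update_self _ _ _
  -- the counts of `Q'` and of `𝔱^λ` at `k + 1`
  have hP : ∀ t, pcount Q' (k + 1) t + min s t = pcount Q k t + min (s + 1) t := by
    intro t
    have := pcount_succ Q' k t
    rwa [hQ'k, pcount_congr hagree, pbs_congr hagree] at this
  have hN : ∀ t, pcount μ.rowOf (k + 1) t + min c₀ t = pcount μ.rowOf k t + min (c₀ + 1) t := by
    intro t
    have := pcount_succ μ.rowOf k t
    rwa [pbs_rowOf_self] at this
  have hs1 : 1 ≤ s := pbs_pos_of_mem hc
  have hBr : B ≤ r + 1 := card_plabels_le_of_pdom h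
  have hA : ∀ t, pcount Q k t + t ≤ B * t + min s t := fun t => pcount_add_le_of_mem Q k t hc
  have hNle : ∀ t ≤ c₀ + 1, pcount μ.rowOf k t = r * t + min c₀ t := fun t ht => pcount_rowOf_of_le μ k ht
  have weak : ∀ t, pcount Q' (k + 1) t ≤ pcount μ.rowOf (k + 1) t := by
    intro t
    have h1 := h.1 t
    have e1 := hP t
    have e2 := hN t
    by_cases ht : c₀ + 1 ≤ t
    · have : min s t ≤ min (s + 1) t := min_le_min (Nat.le_succ _) le_rfl
      have : min (c₀ + 1) t = min c₀ t + 1 := by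
        rw [min_eq_left ht, min_eq_left (by omega)]
      have : min (s + 1) t ≤ min s t + 1 := by omega
      omega
    · push Not at ht
      have e3 := hNle t ht.le
      have e4 := hA t
      have e5 : B * t ≤ r * t + t := by nlinarith
      have : min c₀ t = t := min_eq_right (by omega)
      have : min (c₀ + 1) t = t := min_eq_right (by omega)
      by_cases hst : t ≤ s
      · rw [min_eq_right hst, min_eq_right (by omega)] at e1
        omega
      · push Not at hst
        rw [min_eq_left hst.le, min_eq_left (by omega)] at e1
        rw [min_eq_left hst.le] at e4
        omega
  refine ⟨weak, ?_⟩
  by_cases hsc : c₀ ≤ s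
  · obtain ⟨t₀, ht₀⟩ := h.2
    refine ⟨t₀, ?_⟩
    have e1 := hP t₀
    have e2 := hN t₀
    have : min (s + 1) t₀ + min c₀ t₀ ≤ min s t₀ + min (c₀ + 1) t₀ := by omega
    omega
  · push Not at hsc
    refine ⟨c₀ + 1, ?_⟩
    have e1 := hP (c₀ + 1)
    have e2 := hN (c₀ + 1)
    have e3 := hNle (c₀ + 1) le_rfl
    have e4 := hA (c₀ + 1)
    have e5 : B * (c₀ + 1) ≤ r * (c₀ + 1) + (c₀ + 1) := by nlinarith
    rw [min_eq_left (by omega : s ≤ c₀ + 1), min_eq_left (by omega : s + 1 ≤ c₀ + 1)] at e1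
    rw [min_eq_left (by omega : s ≤ c₀ + 1)] at e4
    rw [min_eq_left (Nat.le_succ c₀), min_self] at e2
    rw [min_eq_left (Nat.le_succ c₀)] at e3
    omega

/-- **Propagation (D3)**: if `Q ▷ 𝔱^λ` on the entries `< k`, `k` is alone in its block, and `Q`
meets fewer than `row(k) + 1` blocks before `k`, then `Q ▷ 𝔱^λ` on the entries `≤ k`. [folklore] -/
theorem pdom_succ_of_card_lt {k : Fin n} {Q : Fin n → ℕ} (h : PDom μ k Q) (hk : Q k ∉ plabels Q k)
    (hB : (plabels Q k).card < μ.rowOf k + 1) : PDom μ (k + 1) Q := by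
  set r := μ.rowOf k with hr
  set c₀ := μ.colOf k with hc₀
  set B := (plabels Q k).card with hBdef
  have hP : ∀ t, pcount Q (k + 1) t = pcount Q k t + min 1 t := by
    intro t
    have := pcount_succ Q k t
    rwa [pbs_eq_zero_of_not_mem hk, Nat.zero_min, add_zero, zero_add] at this
  have hN : ∀ t, pcount μ.rowOf (k + 1) t + min c₀ t = pcount μ.rowOf k t + min (c₀ + 1) t := by
    intro t
    have := pcount_succ μ.rowOf k t
    rwa [pbs_rowOf_self] at this
  have hA : ∀ t, pcount Q k t ≤ B * t := fun t => pcount_le_card_mul Q k t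
  have hNle : ∀ t ≤ c₀ + 1, pcount μ.rowOf k t = r * t + min c₀ t := fun t ht => pcount_rowOf_of_le μ k ht
  have weak : ∀ t, pcount Q (k + 1) t ≤ pcount μ.rowOf (k + 1) t := by
    intro t
    have h1 := h.1 t
    have e1 := hP t
    have e2 := hN t
    by_cases ht : c₀ + 1 ≤ t
    · have : min (c₀ + 1) t = min c₀ t + 1 := by rw [min_eq_left ht, min_eq_left (by omega)]
      have : min 1 t = 1 := min_eq_left (by omega)
      omega
    · push Not at ht
      rcases Nat.eq_zero_or_pos t with rfl | htpos
      · simp [pcount_zero]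
      · have e3 := hNle t ht.le
        have e4 := hA t
        have e5 : B * t + t ≤ r * t + t := by nlinarith
        have : min c₀ t = t := min_eq_right (by omega)
        have : min (c₀ + 1) t = t := min_eq_right (by omega)
        have : min 1 t = 1 := min_eq_left htpos
        omega
  refine ⟨weak, ?_⟩
  rcases Nat.eq_zero_or_pos c₀ with hc0 | hcpos
  · obtain ⟨t₀, ht₀⟩ := h.2
    refine ⟨t₀, ?_⟩
    have e1 := hP t₀
    have e2 := hN t₀
    rw [hc0, Nat.zero_min, add_zero, zero_add] at e2
    omega
  · refine ⟨c₀ + 1, ?_⟩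
    have e1 := hP (c₀ + 1)
    have e2 := hN (c₀ + 1)
    have e3 := hNle (c₀ + 1) le_rfl
    have e4 := hA (c₀ + 1)
    have e5 : B * (c₀ + 1) + (c₀ + 1) ≤ r * (c₀ + 1) + (c₀ + 1) := by nlinarith
    rw [min_eq_left (Nat.le_succ c₀), min_self] at e2
    rw [min_eq_left (Nat.le_succ c₀)] at e3
    rw [min_eq_left (by omega : 1 ≤ c₀ + 1)] at e1
    omega

/-- **The terms of step (a) (D1)**: merging `k` into a row `i` above its own row gives a labelling
with `▷ 𝔱^λ` on the entries `≤ k`. [folklore] -/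
theorem pdom_succ_update_rowOf {k : Fin n} {i : ℕ} (hi : i < μ.rowOf k) : PDom μ (k + 1) (Function.update μ.rowOf k i) := by
  set Q' := Function.update μ.rowOf k i with hQ'
  set c₀ := μ.colOf k with hc₀
  have hagree : ∀ j : Fin n, (j : ℕ) < k → Q' j = μ.rowOf j := fun j hj => Function.update_of_ne (Fin.ne_of_lt (Fin.lt_def.2 hj)) _ _
  have hQ'k : Q' k = i := Function.update_self _ _ _
  have hsi : c₀ + 1 ≤ pbs μ.rowOf k i := by
    rw [pbs_rowOf_of_lt μ k hi]
    exact (colOf_lt_rowLen μ k).trans_le (μ.youngDiagram.rowLen_anti i _ hi.le)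
  have hP : ∀ t, pcount Q' (k + 1) t + min (pbs μ.rowOf k i) t = pcount μ.rowOf k t + min (pbs μ.rowOf k i + 1) t := by
    intro t
    have := pcount_succ Q' k t
    rwa [hQ'k, pcount_congr hagree, pbs_congr hagree] at this
  have hN : ∀ t, pcount μ.rowOf (k + 1) t + min c₀ t = pcount μ.rowOf k t + min (c₀ + 1) t := by
    intro t
    have := pcount_succ μ.rowOf k t
    rwa [pbs_rowOf_self] at this
  refine ⟨fun t => ?_, ⟨c₀ + 1, ?_⟩⟩
  · have e1 := hP t
    have e2 := hN t
    have : min (pbs μ.rowOf k i + 1) t + min c₀ t ≤ min (pbs μ.rowOf k i) t + min (c₀ + 1) t := by omega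
    omega
  · have e1 := hP (c₀ + 1)
    have e2 := hN (c₀ + 1)
    rw [min_eq_right (by omega : c₀ + 1 ≤ pbs μ.rowOf k i), min_eq_right (by omega : c₀ + 1 ≤ pbs μ.rowOf k i + 1)] at e1
    rw [min_eq_left (Nat.le_succ c₀), min_self] at e2
    omega

end PDom


/-! ### The product formula `∏_k (L_k + r_k + 1) ≡ x_λ (mod J^{▷λ})` -/

section JMProduct

variable {n : ℕ} (μ : Nat.Partition n)

/-- **`ν_m`**: the rows of `𝔱^λ` on the entries `< m`, and the other entries as singletons (fresh
labels `n + 1 + e`). [folklore] -/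
def nuLab (m : ℕ) : Fin n → ℕ := fun e => if (e : ℕ) < m then μ.rowOf e else n + 1 + e

/-- The values on the entries `< m`. [folklore] -/
theorem nuLab_of_lt {m : ℕ} {e : Fin n} (h : (e : ℕ) < m) : nuLab μ m e = μ.rowOf e := if_pos h

/-- The values on the entries `≥ m`. [folklore] -/
theorem nuLab_of_le {m : ℕ} {e : Fin n} (h : m ≤ (e : ℕ)) : nuLab μ m e = n + 1 + e := if_neg (not_lt.2 h)

/-- `ν_n = 𝔱^λ`. [folklore] -/
theorem nuLab_n : nuLab μ n = μ.rowOf := funext fun e => nuLab_of_lt μ e.2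

/-- `ν_0` is all singletons. [folklore] -/
theorem nuLab_zero_injective : Function.Injective (nuLab μ 0) := fun e e' h => by
  rw [nuLab_of_le μ (Nat.zero_le _), nuLab_of_le μ (Nat.zero_le _)] at h
  exact Fin.ext (by omega)

/-- **The entries `≥ m` are alone in their blocks.** [folklore] -/
def SingGE (m : ℕ) (Q : Fin n → ℕ) : Prop := ∀ e e' : Fin n, m ≤ (e : ℕ) → Q e = Q e' → e = e'

/-- `ν_m` has its entries `≥ m` alone. [folklore] -/
theorem singGE_nuLab (m : ℕ) : SingGE m (nuLab μ m) := by
  intro e e' he h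
  rw [nuLab_of_le μ he] at h
  by_cases he' : (e' : ℕ) < m
  · rw [nuLab_of_lt μ he'] at h
    have := rowOf_lt μ e'
    omega
  · rw [nuLab_of_le μ (not_lt.1 he')] at h
    exact Fin.ext (by omega)

variable {μ}

/-- Monotonicity in `m`. [folklore] -/
theorem SingGE.mono {m m' : ℕ} (h : m ≤ m') {Q : Fin n → ℕ} (hQ : SingGE m Q) : SingGE m' Q :=
  fun e e' he => hQ e e' (h.trans he)

/-- The entry `k ≥ m` is alone (the hypothesis of the coset expansion). [folklore] -/
theorem SingGE.eq_of_eq {m : ℕ} {Q : Fin n → ℕ} (hQ : SingGE m Q) {k : Fin n} (hk : m ≤ (k : ℕ)) (e : Fin n) (h : Q e = Q k) :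
    e = k :=
  (hQ k e hk h.symm).symm

/-- A label met before the entry `k = m` is not the label of `k`. [folklore] -/
theorem SingGE.ne_of_mem_plabels {m : ℕ} {Q : Fin n → ℕ} (hQ : SingGE m Q) {k : Fin n} (hk : (k : ℕ) = m) {c : ℕ}
    (hc : c ∈ plabels Q k) : c ≠ Q k := by
  rintro rfl
  obtain ⟨j, hj, hjc⟩ := mem_plabels.1 hc
  have := hQ k j (by omega) hjc.symm
  subst this
  exact lt_irrefl _ hj

/-- The block of a label met before `k = m` consists of entries `< k`. [folklore] -/
theorem SingGE.filter_eq {m : ℕ} {Q : Fin n → ℕ} (hQ : SingGE m Q) {k : Fin n} (hk : (k : ℕ) = m) {c : ℕ}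
    (hc : c ∈ plabels Q k) :
    (Finset.univ.filter fun j : Fin n => Q j = c) = Finset.univ.filter fun j : Fin n => j < k ∧ Q j = c := by
  ext j
  simp only [Finset.mem_filter, Finset.mem_univ, true_and]
  constructor
  · intro hj
    refine ⟨?_, hj⟩
    by_contra hjk
    obtain ⟨j₀, hj₀, hj₀c⟩ := mem_plabels.1 hc
    have := hQ j j₀ (by rw [← hk]; exact Fin.le_def.1 (not_lt.1 hjk)) (hj.trans hj₀c.symm)
    subst this
    exact hjk (Fin.lt_def.2 hj₀)
  · exact fun h => h.2

/-- Merging `k = m` into a met block keeps the entries `≥ m + 1` alone. [folklore] -/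
theorem SingGE.update {m : ℕ} {Q : Fin n → ℕ} (hQ : SingGE m Q) {k : Fin n} (hk : (k : ℕ) = m) {c : ℕ}
    (hc : c ∈ plabels Q k) : SingGE (m + 1) (Function.update Q k c) := by
  intro e e' he h
  have hek : e ≠ k := fun h' => by subst h'; omega
  rw [Function.update_of_ne hek] at h
  by_cases he'k : e' = k
  · subst he'k
    rw [Function.update_self] at h
    obtain ⟨j₀, hj₀, hj₀c⟩ := mem_plabels.1 hc
    have := hQ e j₀ (by omega) (h.trans hj₀c.symm)
    subst this
    omega
  · rw [Function.update_of_ne he'k] at h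
    exact hQ e e' (by omega) h

/-- **The permutations fixing the entries `≥ m`** (the subgroup `S_m`). [folklore] -/
def FixGE (m : ℕ) (g : Perm (Fin n)) : Prop := ∀ e : Fin n, m ≤ (e : ℕ) → g e = e

/-- Monotonicity in `m`. [folklore] -/
theorem FixGE.mono {m m' : ℕ} (h : m ≤ m') {g : Perm (Fin n)} (hg : FixGE m g) : FixGE m' g :=
  fun e he => hg e (h.trans he)

/-- `1` fixes everything. [folklore] -/
theorem fixGE_one (m : ℕ) : FixGE m (1 : Perm (Fin n)) := fun _ _ => rfl

/-- A permutation fixing the entries `≥ m = k` permutes the entries `< k`. [folklore] -/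
theorem FixGE.lt_iff {m : ℕ} {g : Perm (Fin n)} (hg : FixGE m g) {k : Fin n} (hk : (k : ℕ) = m) (j : Fin n) :
    g j < k ↔ j < k := by
  constructor
  · intro h
    by_contra hjk
    have := hg j (by rw [← hk]; exact Fin.le_def.1 (not_lt.1 hjk))
    rw [this] at h
    exact hjk h
  · intro h
    by_contra hgk
    have h1 := hg (g j) (by rw [← hk]; exact Fin.le_def.1 (not_lt.1 hgk))
    have := g.injective h1
    rw [this] at hgk
    exact hgk h

/-- **`S_m` commutes with `L_m`**: `h L_k = L_k h` when `h` fixes the entries `≥ k`. [folklore] -/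
theorem of_mul_jucysMurphy_of_fixGE {m : ℕ} {h : Perm (Fin n)} (hh : FixGE m h) {k : Fin n} (hk : (k : ℕ) = m) :
    MonoidAlgebra.of R _ h * jucysMurphy R k = jucysMurphy R k * MonoidAlgebra.of R _ h := by
  classical
  rw [jucysMurphy, Finset.mul_sum, Finset.sum_mul]
  simp_rw [← map_mul]
  have hk' : h k = k := hh k (by omega)
  refine Finset.sum_bij' (fun j _ => h j) (fun j _ => h⁻¹ j) (fun j hj => ?_) (fun j hj => ?_) (fun j _ => by simp)
    (fun j _ => by simp) (fun j _ => ?_)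
  · rw [Finset.mem_filter] at hj ⊢
    exact ⟨Finset.mem_univ _, (hh.lt_iff hk j).2 hj.2⟩
  · rw [Finset.mem_filter] at hj ⊢
    refine ⟨Finset.mem_univ _, ?_⟩
    have := hh.lt_iff hk (h⁻¹ j)
    simp only [Perm.inv_def, Equiv.apply_symm_apply] at this
    exact this.1 hj.2
  · congr 1
    conv_rhs => rw [← hk', swap_apply_apply]
    rw [inv_mul_cancel_right]

open scoped Classical in
/-- **`x_Q L_k = ∑_{met blocks c} (x_{Q[k ↦ c]} - x_Q)`** for `Q` with its entries `≥ k` alone. [folklore] -/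
theorem blockSum_mul_jucysMurphy {m : ℕ} {Q : Fin n → ℕ} (hQ : SingGE m Q) {k : Fin n} (hk : (k : ℕ) = m) :
    blockSum R Q * jucysMurphy R k = ∑ c ∈ plabels Q k, (blockSum R (Function.update Q k c) - blockSum R Q) := by
  rw [jucysMurphy, ← Finset.sum_fiberwise_of_maps_to (s := Finset.univ.filter fun j : Fin n => j < k) (t := plabels Q k) (g := Q)
      (fun j hj => mem_plabels.2 ⟨j, Fin.lt_def.1 (Finset.mem_filter.1 hj).2, rfl⟩), Finset.mul_sum]
  refine Finset.sum_congr rfl fun c hc => ?_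
  rw [Finset.filter_filter, show (Finset.univ.filter fun j : Fin n => j < k ∧ Q j = c) = Finset.univ.filter fun j => Q j = c from
      (hQ.filter_eq hk hc).symm,
    blockSum_mul_sum_swap R Q k (hQ.eq_of_eq (by omega)) (hQ.ne_of_mem_plabels hk hc)]

variable (μ)

/-- **Step (a): `x_{ν_m} (L_m + r + 1) = ∑_{i ≤ r} x_{ν_m[m ↦ i]}`** (`r` the row of the entry `m`):
split `L_m` by the rows of `𝔱^λ` and apply the coset expansion to each. [folklore] -/
theorem blockSum_nuLab_mul (k : Fin n) :
    blockSum R (nuLab μ k) * (jucysMurphy R k + ((μ.rowOf k + 1 : ℕ) : MonoidAlgebra R (Perm (Fin n)))) =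
      ∑ i ∈ Finset.range (μ.rowOf k + 1), blockSum R (Function.update (nuLab μ k) k i) := by
  classical
  have hL : jucysMurphy R k = ∑ i ∈ Finset.range (μ.rowOf k + 1),
      ∑ j ∈ Finset.univ.filter (fun j : Fin n => nuLab μ k j = i), MonoidAlgebra.of R _ (swap j k) := by
    rw [jucysMurphy, ← Finset.sum_fiberwise_of_maps_to (s := Finset.univ.filter fun j : Fin n => j < k)
      (t := Finset.range (μ.rowOf k + 1)) (g := μ.rowOf) (fun j hj => Finset.mem_range.2 (Nat.lt_succ_of_le
        (rowOf_mono μ (Finset.mem_filter.1 hj).2.le)))]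
    refine Finset.sum_congr rfl fun i hi => Finset.sum_congr ?_ fun _ _ => rfl
    ext j
    simp only [Finset.mem_filter, Finset.mem_univ, true_and]
    constructor
    · rintro ⟨hj, hji⟩; rw [nuLab_of_lt μ (Fin.lt_def.1 hj), hji]
    · intro h
      by_cases hj : (j : ℕ) < k
      · rw [nuLab_of_lt μ hj] at h; exact ⟨Fin.lt_def.2 hj, h⟩
      · rw [nuLab_of_le μ (not_lt.1 hj)] at h
        have := Finset.mem_range.1 hi
        have := rowOf_lt μ k
        omega
  have halone : ∀ e, nuLab μ k e = nuLab μ k k → e = k := (singGE_nuLab μ k).eq_of_eq le_rfl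
  rw [mul_add, hL, Finset.mul_sum, Finset.sum_congr rfl (fun i hi => blockSum_mul_sum_swap R (nuLab μ k) k halone (by
      rw [nuLab_of_le μ le_rfl]
      have := Finset.mem_range.1 hi
      have := rowOf_lt μ k
      omega)), Finset.sum_sub_distrib, Finset.sum_const, Finset.card_range, ← nsmul_eq_mul']
  abel

/-- `ν_m[m ↦ r] = ν_{m+1}`. [folklore] -/
theorem update_nuLab_self (k : Fin n) : Function.update (nuLab μ k) k (μ.rowOf k) = nuLab μ (k + 1) := by
  funext e
  by_cases he : e = k
  · subst he; rw [Function.update_self, nuLab_of_lt μ (Nat.lt_succ_self _)]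
  · rw [Function.update_of_ne he]
    have hne : (e : ℕ) ≠ k := fun h => he (Fin.ext h)
    by_cases hlt : (e : ℕ) < k
    · rw [nuLab_of_lt μ hlt, nuLab_of_lt μ (Nat.lt_succ_of_lt hlt)]
    · rw [nuLab_of_le μ (not_lt.1 hlt), nuLab_of_le μ (by omega)]

/-- The rows above the row of `k` are met before `k`. [folklore] -/
theorem mem_plabels_of_lt (k : Fin n) {i : ℕ} (hi : i < μ.rowOf k) {Q : Fin n → ℕ} (hQ : ∀ j : Fin n, (j : ℕ) < k → Q j = μ.rowOf j) :
    i ∈ plabels Q k := by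
  have hpos : 0 < blockSize μ.rowOf i := by
    rw [blockSize_rowOf]
    exact (Nat.zero_le _).trans_lt ((colOf_lt_rowLen μ k).trans_le (μ.youngDiagram.rowLen_anti i _ hi.le))
  obtain ⟨j, hj⟩ := Finset.card_pos.1 hpos
  rw [Finset.mem_filter] at hj
  have hjk : (j : ℕ) < k := Fin.lt_def.1 (lt_of_rowOf_lt μ (by rw [hj.2]; exact hi))
  exact mem_plabels.2 ⟨j, hjk, by rw [hQ j hjk, hj.2]⟩

/-- **The local ideals `I_m`**: the span of the `g x_Q h` with `g, h ∈ S_m`, `Q` with its entries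
`≥ m` alone, and `Q ▷ 𝔱^λ` on the entries `< m`. At `m = n`, `I_n ⊆ J^{▷λ}`. [folklore] -/
def locIdeal (m : ℕ) : Submodule R (MonoidAlgebra R (Perm (Fin n))) :=
  Submodule.span R {x | ∃ (g h : Perm (Fin n)) (Q : Fin n → ℕ), FixGE m g ∧ FixGE m h ∧ SingGE m Q ∧ PDom μ m Q ∧
    x = MonoidAlgebra.of R _ g * blockSum R Q * MonoidAlgebra.of R _ h}

/-- **Step (b): `I_m · (L_m + r + 1) ⊆ I_{m+1}`.** For a generator `g x_Q h`: `h` commutes with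
`L_m`, `x_Q (L_m + r + 1) = ∑_{met c} x_{Q[m ↦ c]} + (r + 1 - B) x_Q` with `B ≤ r + 1` the number of
met blocks, every `Q[m ↦ c] ▷ 𝔱^λ` on the entries `≤ m` (D2), and `Q ▷ 𝔱^λ` there unless `B = r + 1`
(D3). [folklore] -/
theorem locIdeal_mul_mem (k : Fin n) {x : MonoidAlgebra R (Perm (Fin n))} (hx : x ∈ locIdeal R μ k) :
    x * (jucysMurphy R k + ((μ.rowOf k + 1 : ℕ) : MonoidAlgebra R (Perm (Fin n)))) ∈ locIdeal R μ (k + 1) := by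
  induction hx using Submodule.span_induction with
  | mem x hx =>
    obtain ⟨g, h, Q, hg, hh, hQ, hdom, rfl⟩ := hx
    have hcomm : MonoidAlgebra.of R _ h * (jucysMurphy R k + ((μ.rowOf k + 1 : ℕ) : MonoidAlgebra R (Perm (Fin n)))) =
        (jucysMurphy R k + ((μ.rowOf k + 1 : ℕ) : MonoidAlgebra R (Perm (Fin n)))) * MonoidAlgebra.of R _ h := by
      rw [mul_add, add_mul, of_mul_jucysMurphy_of_fixGE R hh rfl, Nat.cast_comm]
    have hexp : blockSum R Q * (jucysMurphy R k + ((μ.rowOf k + 1 : ℕ) : MonoidAlgebra R (Perm (Fin n)))) =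
        ∑ c ∈ plabels Q k, blockSum R (Function.update Q k c) +
          (((μ.rowOf k + 1 : ℕ) : R) - ((plabels Q k).card : R)) • blockSum R Q := by
      rw [mul_add, blockSum_mul_jucysMurphy R hQ rfl, Finset.sum_sub_distrib, Finset.sum_const, ← nsmul_eq_mul', sub_smul,
        ← Nat.cast_smul_eq_nsmul R, ← Nat.cast_smul_eq_nsmul R]
      abel
    rw [mul_assoc, hcomm, ← mul_assoc, mul_assoc (MonoidAlgebra.of R _ g), hexp, mul_add, add_mul, Finset.mul_sum, Finset.sum_mul,
      mul_smul_comm, smul_mul_assoc]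
    refine Submodule.add_mem _ (Submodule.sum_mem _ fun c hc => Submodule.subset_span ⟨g, h, _, hg.mono (Nat.le_succ _),
      hh.mono (Nat.le_succ _), hQ.update rfl hc, pdom_succ_update hdom hc, rfl⟩) ?_
    by_cases hB : (plabels Q k).card = μ.rowOf k + 1
    · rw [hB, sub_self, zero_smul]; exact Submodule.zero_mem _
    · refine Submodule.smul_mem _ _ (Submodule.subset_span ⟨g, h, Q, hg.mono (Nat.le_succ _), hh.mono (Nat.le_succ _),
        hQ.mono (Nat.le_succ _), pdom_succ_of_card_lt hdom (fun hmem => hQ.ne_of_mem_plabels rfl hmem rfl)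
          (lt_of_le_of_ne (card_plabels_le_of_pdom hdom) hB), rfl⟩)
  | zero => rw [zero_mul]; exact Submodule.zero_mem _
  | add x y _ _ hx hy => rw [add_mul]; exact Submodule.add_mem _ hx hy
  | smul r x _ hx => rw [smul_mul_assoc]; exact Submodule.smul_mem _ r hx

/-- **The product `∏_{k < m} (L_k + r_k + 1)`** (increasing `k`; the factors commute). [folklore] -/
def jmProd : ℕ → MonoidAlgebra R (Perm (Fin n))
  | 0 => 1
  | m + 1 => jmProd m * if h : m < n then
      jucysMurphy R ⟨m, h⟩ + ((μ.rowOf ⟨m, h⟩ + 1 : ℕ) : MonoidAlgebra R (Perm (Fin n))) else 1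

/-- The recursion. [folklore] -/
theorem jmProd_succ (k : Fin n) :
    jmProd R μ (k + 1) = jmProd R μ k * (jucysMurphy R k + ((μ.rowOf k + 1 : ℕ) : MonoidAlgebra R (Perm (Fin n)))) := by
  rw [jmProd, dif_pos k.2]

/-- `jmProd 0 = 1`. [folklore] -/
theorem jmProd_zero : jmProd R μ 0 = 1 := rfl

/-- **`∏_{k < m} (L_k + r_k + 1) - x_{ν_m} ∈ I_m`** for all `m ≤ n` (induction on `m` with steps (a)
and (b)). [folklore] -/
theorem jmProd_sub_blockSum_nuLab_mem : ∀ m, m ≤ n → jmProd R μ m - blockSum R (nuLab μ m) ∈ locIdeal R μ m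
  | 0, _ => by
    rw [jmProd_zero, blockSum_eq_one_of_injective R (nuLab_zero_injective μ), sub_self]
    exact Submodule.zero_mem _
  | m + 1, hm => by
    have hm' : m < n := hm
    set k : Fin n := ⟨m, hm'⟩ with hk
    have ih := jmProd_sub_blockSum_nuLab_mem m hm'.le
    have e1 : jmProd R μ (m + 1) = jmProd R μ (k + 1) := rfl
    have e2 : nuLab μ (m + 1) = nuLab μ (k + 1) := rfl
    have e3 : jmProd R μ m = jmProd R μ k := rfl
    have e4 : nuLab μ m = nuLab μ k := rfl
    have e5 : locIdeal R μ (m + 1) = locIdeal R μ (k + 1) := rfl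
    rw [e3, e4] at ih
    rw [e1, e2, e5, jmProd_succ, show jmProd R μ k * (jucysMurphy R k + ((μ.rowOf k + 1 : ℕ) : MonoidAlgebra R (Perm (Fin n)))) -
        blockSum R (nuLab μ (k + 1)) = (jmProd R μ k - blockSum R (nuLab μ k)) *
          (jucysMurphy R k + ((μ.rowOf k + 1 : ℕ) : MonoidAlgebra R (Perm (Fin n)))) +
        (blockSum R (nuLab μ k) * (jucysMurphy R k + ((μ.rowOf k + 1 : ℕ) : MonoidAlgebra R (Perm (Fin n)))) -
          blockSum R (nuLab μ (k + 1))) by rw [sub_mul]; abel]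
    refine Submodule.add_mem _ (locIdeal_mul_mem R μ k ih) ?_
    -- step (a)
    rw [blockSum_nuLab_mul, Finset.sum_range_succ, update_nuLab_self, add_sub_cancel_right]
    refine Submodule.sum_mem _ fun i hi => Submodule.subset_span ⟨1, 1, Function.update (nuLab μ k) k i, fixGE_one _, fixGE_one _,
      ?_, ?_, by rw [map_one, one_mul, mul_one]⟩
    · exact (singGE_nuLab μ k).update rfl (mem_plabels_of_lt μ k (Finset.mem_range.1 hi) fun j hj => nuLab_of_lt μ hj)
    · have hagree : ∀ j : Fin n, (j : ℕ) < (k : ℕ) + 1 → Function.update (nuLab μ k) k i j = Function.update μ.rowOf k i j := by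
        intro j hj
        by_cases hjk : j = k
        · subst hjk; rw [Function.update_self, Function.update_self]
        · rw [Function.update_of_ne hjk, Function.update_of_ne hjk, nuLab_of_lt μ]
          have : (j : ℕ) ≠ k := fun h => hjk (Fin.ext h)
          omega
      unfold PDom
      rw [pcount_congr hagree]
      exact pdom_succ_update_rowOf (Finset.mem_range.1 hi)

/-- **The product formula (level one):** in `R[S_n]`, for every commutative ring `R`,
`∏_{k} (L_k + r_k + 1) ≡ x_λ (mod J^{▷λ})`, `r_k` the (0-based) row of `k` in `𝔱^λ` — an integral
substitute for Hu–Mathas' Lemma 39 / Theorem 40 / Corollary 42 (computation of `e_λ y_λ` through the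
seminormal idempotents `F_𝔱` and `γ_𝔱`): since `(L_k + r_k + 1) e_λ = (c_k + 1 + y_k) e_λ` in
`𝔽_p S_n` (`c_k` the 0-based column), it gives `e_λ y_λ ≡ c_λ x_λ (mod J^{▷λ})` with `c_λ ≠ 0`.
[cite: HuMathas2010, §4.3 Cor. 42] -/
theorem jmProd_sub_murphyX_mem_domIdeal : jmProd R μ n - murphyX R μ ∈ domIdeal R μ.rowOf := by
  have key := jmProd_sub_blockSum_nuLab_mem R μ n le_rfl
  rw [nuLab_n, ← murphyX_eq_blockSum] at key
  refine (Submodule.span_le.2 ?_) key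
  rintro x ⟨g, h, Q, -, -, -, hdom, rfl⟩
  exact conj_blockSum_mem_domIdeal R ((pdom_n_iff μ Q).1 hdom) g h

end JMProduct


/-! ### The KLR idempotents as polynomials in the Jucys–Murphy elements (Hu–Mathas §4.1) -/

section WeightPoly

open Polynomial

variable (k : Type*) [Field k] [DecidableEq k] {n : ℕ}

/-- The candidate eigenvalues `{-r, …, r} · 1_k` of `L_r`. [folklore] -/
def jmSpec (r : Fin n) : Finset k := (Finset.Icc (-(r : ℤ)) r).image fun c : ℤ => (c : k)

/-- A candidate residue sequence has its values among the candidate eigenvalues. [folklore] -/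
theorem apply_mem_jmSpec {χ : Fin n → k} (hχ : χ ∈ residueSeqs k n) (r : Fin n) : χ r ∈ jmSpec k r := by
  rw [residueSeqs, Fintype.mem_piFinset] at hχ
  exact hχ r

/-- **CRT polynomials**: for each `r` a polynomial `P_r ≡ 1 (mod (X - i_r)^{n!})` divisible by
`(X - c)^{n!}` for every other candidate eigenvalue `c` of `L_r`. [folklore] -/
theorem exists_weightPoly (χ : Fin n → k) (r : Fin n) :
    ∃ P a : k[X], P = 1 - a * (X - C (χ r)) ^ n.factorial ∧
      ∀ c ∈ (jmSpec k r).erase (χ r), ∃ q : k[X], P = q * (X - C c) ^ n.factorial := by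
  classical
  have hcop : IsCoprime ((X - C (χ r)) ^ n.factorial) (∏ c ∈ (jmSpec k r).erase (χ r), (X - C c) ^ n.factorial) := by
    refine IsCoprime.prod_right fun c hc => IsCoprime.pow ?_
    exact pairwise_coprime_X_sub_C (s := fun x : k => x) (fun _ _ h => h) (Ne.symm (Finset.mem_erase.1 hc).1)
  obtain ⟨a, b, hab⟩ := hcop
  refine ⟨b * ∏ c ∈ (jmSpec k r).erase (χ r), (X - C c) ^ n.factorial, a, ?_, fun c hc => ?_⟩
  · linear_combination hab
  · obtain ⟨q, hq⟩ := Finset.dvd_prod_of_mem (fun c => (X - C c) ^ n.factorial) hc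
    exact ⟨b * q, by rw [hq]; ring⟩

/-- The chosen CRT polynomial `P_r` of `𝐢`. [folklore] -/
def weightPoly (χ : Fin n → k) (r : Fin n) : k[X] := (exists_weightPoly k χ r).choose

/-- Its defining properties. [folklore] -/
theorem weightPoly_spec (χ : Fin n → k) (r : Fin n) :
    ∃ a : k[X], weightPoly k χ r = 1 - a * (X - C (χ r)) ^ n.factorial ∧
      ∀ c ∈ (jmSpec k r).erase (χ r), ∃ q : k[X], weightPoly k χ r = q * (X - C c) ^ n.factorial :=
  (exists_weightPoly k χ r).choose_spec

/-- The factor `P_r(L_r)`. [folklore] -/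
def weightFactor (χ : Fin n → k) (r : Fin n) : MonoidAlgebra k (Perm (Fin n)) :=
  aeval (jucysMurphy k r) (weightPoly k χ r)

omit [DecidableEq k] in
/-- Polynomials in commuting elements commute. [folklore] -/
theorem commute_aeval_jucysMurphy (r t : Fin n) (p q : k[X]) :
    Commute (aeval (jucysMurphy k r) p) (aeval (jucysMurphy k t) q) := by
  refine Algebra.commute_of_mem_adjoin_of_forall_mem_commute (s := {jucysMurphy k t})
    (Polynomial.aeval_mem_adjoin_singleton k (jucysMurphy k t)) ?_
  rintro b rfl
  symm
  refine Algebra.commute_of_mem_adjoin_of_forall_mem_commute (s := {jucysMurphy k r})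
    (Polynomial.aeval_mem_adjoin_singleton k (jucysMurphy k r)) ?_
  rintro b rfl
  exact commute_jucysMurphy k t r

/-- **The product `E(𝐢) = ∏_r P_r(L_r)`** (increasing `r`; the factors commute). [folklore] -/
def weightElt (χ : Fin n → k) : MonoidAlgebra k (Perm (Fin n)) :=
  ((List.finRange n).map (weightFactor k χ)).prod

omit [DecidableEq k] in
/-- `(L_r - c)^{n!}` kills the generalized `c`-eigenspace of `L_r`. [folklore] -/
theorem sub_pow_mul_eq_zero_of_mem {r : Fin n} {c : k} {v : MonoidAlgebra k (Perm (Fin n))}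
    (hv : v ∈ Module.End.maxGenEigenspace (LinearMap.mulLeft k (jucysMurphy k r)) c) :
    (jucysMurphy k r - algebraMap k _ c) ^ n.factorial * v = 0 := by
  rw [Module.End.maxGenEigenspace_eq_genEigenspace_finrank, Module.End.genEigenspace_nat,
    finrank_monoidAlgebra_perm_eq_factorial, LinearMap.mem_ker] at hv
  have hop : LinearMap.mulLeft k (jucysMurphy k r) - c • (1 : Module.End k _) =
      LinearMap.mulLeft k (jucysMurphy k r - algebraMap k _ c) := by
    symm
    change Algebra.lmul k _ (jucysMurphy k r - algebraMap k _ c) = Algebra.lmul k _ (jucysMurphy k r) - c • 1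
    rw [map_sub, AlgHom.commutes, Algebra.algebraMap_eq_smul_one]
  rw [hop, LinearMap.pow_mulLeft, LinearMap.mulLeft_apply] at hv
  exact hv

omit [DecidableEq k] in
/-- Polynomials in `L_t` preserve the joint eigenspaces. [folklore] -/
theorem aeval_mul_mem_jointEigenspace {χ : Fin n → k} (t : Fin n) (p : k[X]) {v : MonoidAlgebra k (Perm (Fin n))}
    (hv : v ∈ jointEigenspace k χ) : aeval (jucysMurphy k t) p * v ∈ jointEigenspace k χ := by
  induction p using Polynomial.induction_on' with
  | add p q hp hq => rw [map_add, add_mul]; exact Submodule.add_mem _ hp hq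
  | monomial m a =>
    rw [← C_mul_X_pow_eq_monomial, map_mul, aeval_C, map_pow, aeval_X, Algebra.algebraMap_eq_smul_one, smul_mul_assoc, one_mul,
      smul_mul_assoc]
    refine Submodule.smul_mem _ a ?_
    induction m with
    | zero => rwa [pow_zero, one_mul]
    | succ m ih => rw [pow_succ', mul_assoc]; exact jucysMurphy_mul_mem_jointEigenspace k t ih

/-- **The factor `P_r(L_r)` acts on `M_𝐣` as `[j_r = i_r]`.** [folklore] -/
theorem weightFactor_mul_of_mem {χ χ' : Fin n → k} (hχ' : χ' ∈ residueSeqs k n) (r : Fin n) {v : MonoidAlgebra k (Perm (Fin n))}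
    (hv : v ∈ jointEigenspace k χ') : weightFactor k χ r * v = if χ' r = χ r then v else 0 := by
  have hvr : v ∈ Module.End.maxGenEigenspace (LinearMap.mulLeft k (jucysMurphy k r)) (χ' r) := (Submodule.mem_iInf _).1 hv r
  obtain ⟨a, ha, hdiv⟩ := weightPoly_spec k χ r
  split_ifs with h
  · rw [weightFactor, ha, map_sub, map_one, map_mul, map_pow, map_sub, aeval_X, aeval_C, sub_mul, one_mul, mul_assoc, ← h,
      sub_pow_mul_eq_zero_of_mem k hvr, mul_zero, sub_zero]
  · obtain ⟨q, hq⟩ := hdiv (χ' r) (Finset.mem_erase.2 ⟨h, apply_mem_jmSpec k hχ' r⟩)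
    rw [weightFactor, hq, map_mul, map_pow, map_sub, aeval_X, aeval_C, mul_assoc, sub_pow_mul_eq_zero_of_mem k hvr, mul_zero]

/-- The action of a product of factors on `M_𝐣`. [folklore] -/
theorem prod_weightFactor_mul_of_mem {χ χ' : Fin n → k} (hχ' : χ' ∈ residueSeqs k n) {v : MonoidAlgebra k (Perm (Fin n))}
    (hv : v ∈ jointEigenspace k χ') (l : List (Fin n)) :
    (l.map (weightFactor k χ)).prod * v = if ∀ r ∈ l, χ' r = χ r then v else 0 := by
  classical
  induction l with
  | nil => simp
  | cons r l ih =>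
    rw [List.map_cons, List.prod_cons, mul_assoc, ih]
    by_cases hl : ∀ r ∈ l, χ' r = χ r
    · rw [if_pos hl, weightFactor_mul_of_mem k hχ' r hv]
      by_cases hr : χ' r = χ r
      · rw [if_pos hr, if_pos]; simpa [hr] using hl
      · rw [if_neg hr, if_neg]; simp [hr]
    · rw [if_neg hl, mul_zero, if_neg]
      push Not at hl ⊢
      obtain ⟨t, ht, hne⟩ := hl
      exact ⟨t, List.mem_cons_of_mem _ ht, hne⟩

/-- **`E(𝐢) = e(𝐢)`**: the KLR idempotent is the polynomial `∏_r P_r(L_r)` in the Jucys–Murphy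
elements (both act on each `M_𝐣` as `δ_{𝐢𝐣}`, and `k[S_n] = ⊕ M_𝐣`). Hu–Mathas 2010, §4.1 (the
`e(𝐢)` lie in the subalgebra generated by `L_1, …, L_n`). [cite: HuMathas2010, §4.1] -/
theorem weightElt_eq_klrIdempotent (χ : Fin n → k) : weightElt k χ = klrIdempotent k χ := by
  classical
  -- both act in the same way on every `M_𝐣`
  have key : ∀ v : MonoidAlgebra k (Perm (Fin n)), weightElt k χ * v = klrIdempotent k χ * v := by
    intro v
    have hv : v ∈ ⨆ χ' : Fin n → k, jointEigenspace k χ' := by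
      rw [iSup_jointEigenspace_eq_top]; exact Submodule.mem_top
    refine Submodule.iSup_induction (p := jointEigenspace k) (motive := fun v => weightElt k χ * v = klrIdempotent k χ * v) hv
      ?_ ?_ ?_
    · intro χ' x hx
      by_cases hbot : jointEigenspace k χ' = ⊥
      · rw [hbot, Submodule.mem_bot] at hx
        rw [hx, mul_zero, mul_zero]
      have hχ' := mem_residueSeqs_of_ne_bot k hbot
      rw [weightElt, prod_weightFactor_mul_of_mem k hχ' hx]
      by_cases h : χ' = χ
      · subst h; rw [if_pos fun _ _ => rfl, klrIdempotent_mul_of_mem k hx]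
      · rw [klrIdempotent_mul_of_mem_ne k h hx, if_neg]
        intro hall
        exact h (funext fun r => hall r (List.mem_finRange r))
    · rw [mul_zero, mul_zero]
    · intro x y hx hy; rw [mul_add, mul_add, hx, hy]
  have := key 1
  rwa [mul_one, mul_one] at this

/-! #### Congruences: `x L_r ≡ i_r x (mod N)` for all `r` forces `x e(𝐢) ≡ x` and `x e(𝐣) ≡ 0` -/

variable {k}

omit [DecidableEq k] in
/-- A submodule stable under right multiplication by every `L_r` is stable under right
multiplication by every polynomial in an `L_r` … [folklore] -/
theorem mul_aeval_mem_of_forall {N : Submodule k (MonoidAlgebra k (Perm (Fin n)))}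
    (hN : ∀ r, ∀ x ∈ N, x * jucysMurphy k r ∈ N) (t : Fin n) (p : k[X]) {x : MonoidAlgebra k (Perm (Fin n))} (hx : x ∈ N) :
    x * aeval (jucysMurphy k t) p ∈ N := by
  induction p using Polynomial.induction_on' with
  | add p q hp hq => rw [map_add, mul_add]; exact Submodule.add_mem _ hp hq
  | monomial m a =>
    rw [← C_mul_X_pow_eq_monomial, map_mul, aeval_C, map_pow, aeval_X, Algebra.algebraMap_eq_smul_one, smul_mul_assoc, one_mul,
      mul_smul_comm]
    refine Submodule.smul_mem _ a ?_
    induction m with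
    | zero => rwa [pow_zero, mul_one]
    | succ m ih => rw [pow_succ, ← mul_assoc]; exact hN t _ ih

/-- … and by every product of the CRT factors. [folklore] -/
theorem mul_prod_weightFactor_mem_of_forall {N : Submodule k (MonoidAlgebra k (Perm (Fin n)))}
    (hN : ∀ r, ∀ x ∈ N, x * jucysMurphy k r ∈ N) (χ : Fin n → k) (l : List (Fin n)) {x : MonoidAlgebra k (Perm (Fin n))}
    (hx : x ∈ N) : x * (l.map (weightFactor k χ)).prod ∈ N := by
  induction l generalizing x with
  | nil => simpa using hx
  | cons r l ih =>
    rw [List.map_cons, List.prod_cons, ← mul_assoc]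
    exact ih (mul_aeval_mem_of_forall hN r _ hx)

omit [DecidableEq k] in
/-- `x (L_r - i_r)^m ∈ N` once `x L_r - i_r x ∈ N`. [folklore] -/
theorem mul_sub_pow_mem_of_forall {N : Submodule k (MonoidAlgebra k (Perm (Fin n)))}
    (hN : ∀ r, ∀ x ∈ N, x * jucysMurphy k r ∈ N) {x : MonoidAlgebra k (Perm (Fin n))} {r : Fin n} {c : k}
    (hx : x * jucysMurphy k r - c • x ∈ N) (m : ℕ) : x * (jucysMurphy k r - algebraMap k _ c) ^ (m + 1) ∈ N := by
  induction m with
  | zero => rwa [zero_add, pow_one, mul_sub, ← Algebra.commutes, ← Algebra.smul_def]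
  | succ m ih =>
    have h1 := hN r _ ih
    have h2 := Submodule.smul_mem _ c ih
    rw [pow_succ, ← mul_assoc, mul_sub, ← Algebra.commutes, ← Algebra.smul_def]
    exact Submodule.sub_mem _ h1 h2

/-- `x P_r(L_r) ≡ x (mod N)` once `x L_r ≡ i_r x`. [folklore] -/
theorem mul_weightFactor_sub_mem {N : Submodule k (MonoidAlgebra k (Perm (Fin n)))}
    (hN : ∀ r, ∀ x ∈ N, x * jucysMurphy k r ∈ N) {x : MonoidAlgebra k (Perm (Fin n))} (χ : Fin n → k) (r : Fin n)
    (hx : x * jucysMurphy k r - χ r • x ∈ N) : x * weightFactor k χ r - x ∈ N := by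
  obtain ⟨a, ha, -⟩ := weightPoly_spec k χ r
  have hF : aeval (jucysMurphy k r) ((X - C (χ r)) ^ n.factorial) = (jucysMurphy k r - algebraMap k _ (χ r)) ^ n.factorial := by
    rw [map_pow, map_sub, aeval_X, aeval_C]
  have hcomm : aeval (jucysMurphy k r) a * aeval (jucysMurphy k r) ((X - C (χ r)) ^ n.factorial) =
      aeval (jucysMurphy k r) ((X - C (χ r)) ^ n.factorial) * aeval (jucysMurphy k r) a := by
    rw [← map_mul, mul_comm, map_mul]
  have key : x * weightFactor k χ r - x =
      -(x * (jucysMurphy k r - algebraMap k _ (χ r)) ^ n.factorial * aeval (jucysMurphy k r) a) := by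
    rw [weightFactor, ha, map_sub, map_one, map_mul, hcomm, hF, mul_sub, mul_one, sub_sub_cancel_left, mul_assoc]
  rw [key]
  rcases Nat.exists_eq_succ_of_ne_zero (Nat.factorial_ne_zero n) with ⟨m, hm⟩
  rw [hm]
  exact Submodule.neg_mem _ (mul_aeval_mem_of_forall hN r a (mul_sub_pow_mem_of_forall hN hx m))

/-- `x P_r(L_r) ∈ N` for the CRT factor of another sequence `𝐣` with `j_r ≠ i_r`, once
`x L_r ≡ i_r x (mod N)`. [folklore] -/
theorem mul_weightFactor_mem_of_ne {N : Submodule k (MonoidAlgebra k (Perm (Fin n)))}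
    (hN : ∀ r, ∀ x ∈ N, x * jucysMurphy k r ∈ N) {x : MonoidAlgebra k (Perm (Fin n))} {χ χ' : Fin n → k}
    (hχ : χ ∈ residueSeqs k n) (r : Fin n) (hr : χ' r ≠ χ r) (hx : x * jucysMurphy k r - χ r • x ∈ N) :
    x * weightFactor k χ' r ∈ N := by
  obtain ⟨a, -, hdiv⟩ := weightPoly_spec k χ' r
  obtain ⟨q, hq⟩ := hdiv (χ r) (Finset.mem_erase.2 ⟨Ne.symm hr, apply_mem_jmSpec k hχ r⟩)
  have hF : aeval (jucysMurphy k r) ((X - C (χ r)) ^ n.factorial) = (jucysMurphy k r - algebraMap k _ (χ r)) ^ n.factorial := by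
    rw [map_pow, map_sub, aeval_X, aeval_C]
  have hcomm : aeval (jucysMurphy k r) q * aeval (jucysMurphy k r) ((X - C (χ r)) ^ n.factorial) =
      aeval (jucysMurphy k r) ((X - C (χ r)) ^ n.factorial) * aeval (jucysMurphy k r) q := by
    rw [← map_mul, mul_comm, map_mul]
  rw [weightFactor, hq, map_mul, hcomm, hF, ← mul_assoc]
  rcases Nat.exists_eq_succ_of_ne_zero (Nat.factorial_ne_zero n) with ⟨m, hm⟩
  rw [hm]
  exact mul_aeval_mem_of_forall hN r q (mul_sub_pow_mem_of_forall hN hx m)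

/-- **The weight congruence lemma (right version).** Let `N` be a subspace of `k[S_n]` stable
under right multiplication by all `L_r`, and `x` with `x L_r ≡ i_r x (mod N)` for all `r`. Then
`x e(𝐢) ≡ x (mod N)` (from `e(𝐢) = ∏_r P_r(L_r)` with `P_r ≡ 1 mod (X - i_r)^{n!}`). This is how
the Jucys–Murphy triangularity of the Murphy basis passes to the idempotents (Hu–Mathas 2010,
proof of Prop. 35). [cite: HuMathas2010, §4.1–4.2] -/
theorem mul_klrIdempotent_sub_mem {N : Submodule k (MonoidAlgebra k (Perm (Fin n)))}
    (hN : ∀ r, ∀ x ∈ N, x * jucysMurphy k r ∈ N) {x : MonoidAlgebra k (Perm (Fin n))} {χ : Fin n → k}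
    (hx : ∀ r, x * jucysMurphy k r - χ r • x ∈ N) : x * klrIdempotent k χ - x ∈ N := by
  rw [← weightElt_eq_klrIdempotent, weightElt]
  suffices H : ∀ l : List (Fin n), x * (l.map (weightFactor k χ)).prod - x ∈ N from H _
  intro l
  induction l with
  | nil => simp
  | cons r l ih =>
    rw [List.map_cons, List.prod_cons, show x * (weightFactor k χ r * (l.map (weightFactor k χ)).prod) - x =
      (x * weightFactor k χ r - x) * (l.map (weightFactor k χ)).prod + (x * (l.map (weightFactor k χ)).prod - x) by
        rw [sub_mul, mul_assoc, sub_add_sub_cancel]]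
    exact Submodule.add_mem _ (mul_prod_weightFactor_mem_of_forall hN χ l (mul_weightFactor_sub_mem hN χ r (hx r))) ih

/-- **The weight congruence lemma, orthogonality (right version)**: under the same hypotheses,
`x e(𝐣) ≡ 0 (mod N)` for every candidate sequence `𝐣 ≠ 𝐢` (`(X - i_r)^{n!} ∣ P^𝐣_r` at a place
`r` where they differ), provided `𝐢` is a candidate residue sequence. [cite: HuMathas2010, §4.1–4.2] -/
theorem mul_klrIdempotent_mem_of_ne {N : Submodule k (MonoidAlgebra k (Perm (Fin n)))}
    (hN : ∀ r, ∀ x ∈ N, x * jucysMurphy k r ∈ N) {x : MonoidAlgebra k (Perm (Fin n))} {χ : Fin n → k}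
    (hχ : χ ∈ residueSeqs k n) (hx : ∀ r, x * jucysMurphy k r - χ r • x ∈ N) {χ' : Fin n → k} (hne : χ' ≠ χ) :
    x * klrIdempotent k χ' ∈ N := by
  obtain ⟨r, hr⟩ : ∃ r, χ' r ≠ χ r := by
    by_contra hall
    push Not at hall
    exact hne (funext hall)
  -- move the factor `r` to the front
  have hperm : ((List.finRange n).map (weightFactor k χ')).prod =
      weightFactor k χ' r * (((List.finRange n).erase r).map (weightFactor k χ')).prod := by
    have h := List.Perm.prod_eq' (List.Perm.map (weightFactor k χ') (List.perm_cons_erase (List.mem_finRange r))) (by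
      rw [List.pairwise_map]
      exact List.pairwise_of_forall fun a b => commute_aeval_jucysMurphy k a b _ _)
    rw [h, List.map_cons, List.prod_cons]
  rw [← weightElt_eq_klrIdempotent, weightElt, hperm, ← mul_assoc]
  exact mul_prod_weightFactor_mem_of_forall hN χ' _ (mul_weightFactor_mem_of_ne hN hχ r hr (hx r))

/-! #### `e(𝐢)* = e(𝐢)` and the left version -/

variable (k)

omit [DecidableEq k] in
/-- `L_r* = L_r`. [folklore] -/
theorem grpAlgStar_jucysMurphy (r : Fin n) : grpAlgStar k (jucysMurphy k r) = jucysMurphy k r := by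
  rw [jucysMurphy, map_sum]
  exact Finset.sum_congr rfl fun j _ => by rw [grpAlgStar_of, swap_inv]

omit [DecidableEq k] in
/-- `*` fixes the polynomials in an `L_r`. [folklore] -/
theorem grpAlgStar_aeval_jucysMurphy (r : Fin n) (p : k[X]) : grpAlgStar k (aeval (jucysMurphy k r) p) = aeval (jucysMurphy k r) p := by
  induction p using Polynomial.induction_on' with
  | add p q hp hq => rw [map_add, map_add, hp, hq]
  | monomial m a =>
    rw [← C_mul_X_pow_eq_monomial, map_mul, aeval_C, map_pow, aeval_X, Algebra.algebraMap_eq_smul_one, smul_mul_assoc, one_mul,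
      map_smul]
    congr 1
    induction m with
    | zero => rw [pow_zero, grpAlgStar_one]
    | succ m ih =>
      rw [pow_succ', grpAlgStar_mul, ih, grpAlgStar_jucysMurphy]
      exact (Commute.pow_self _ _).eq

/-- `*` fixes the products of the CRT factors. [folklore] -/
theorem grpAlgStar_prod_weightFactor (χ : Fin n → k) (l : List (Fin n)) :
    grpAlgStar k (l.map (weightFactor k χ)).prod = (l.map (weightFactor k χ)).prod := by
  induction l with
  | nil => simp [grpAlgStar_one]
  | cons r l ih =>
    rw [List.map_cons, List.prod_cons, grpAlgStar_mul, ih, weightFactor, grpAlgStar_aeval_jucysMurphy]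
    -- the factors commute
    have : Commute (aeval (jucysMurphy k r) (weightPoly k χ r)) (l.map (weightFactor k χ)).prod :=
      Commute.list_prod_right _ _ fun b hb => by
        rw [List.mem_map] at hb
        obtain ⟨t, -, rfl⟩ := hb
        exact commute_aeval_jucysMurphy k _ _ _ _
    exact this.eq.symm

/-- **`e(𝐢)* = e(𝐢)`** for the anti-involution `g ↦ g⁻¹` (the `e(𝐢)` are polynomials in the
`*`-fixed, commuting `L_r`). [folklore] -/
theorem grpAlgStar_klrIdempotent (χ : Fin n → k) : grpAlgStar k (klrIdempotent k χ) = klrIdempotent k χ := by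
  rw [← weightElt_eq_klrIdempotent, weightElt, grpAlgStar_prod_weightFactor]

variable {k}

/-- **The weight congruence lemma (left version)**: for `N` stable under left multiplication by the
`L_r` and `L_r x ≡ i_r x (mod N)` for all `r`: `e(𝐢) x ≡ x (mod N)`, and `e(𝐣) x ≡ 0 (mod N)` for
candidate sequences `𝐣 ≠ 𝐢` when `𝐢` is one (apply the right version to `x*` and `N*`).
[cite: HuMathas2010, §4.1–4.2] -/
theorem klrIdempotent_mul_congr {N : Submodule k (MonoidAlgebra k (Perm (Fin n)))}
    (hN : ∀ r, ∀ x ∈ N, jucysMurphy k r * x ∈ N) {x : MonoidAlgebra k (Perm (Fin n))} {χ : Fin n → k}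
    (hx : ∀ r, jucysMurphy k r * x - χ r • x ∈ N) :
    klrIdempotent k χ * x - x ∈ N ∧ (χ ∈ residueSeqs k n → ∀ χ', χ' ≠ χ → klrIdempotent k χ' * x ∈ N) := by
  set N' : Submodule k (MonoidAlgebra k (Perm (Fin n))) := N.map (grpAlgStar k (G := Perm (Fin n))).toLinearMap with hN'
  have hmem : ∀ {y}, y ∈ N' ↔ grpAlgStar k y ∈ N := by
    intro y
    rw [hN', Submodule.mem_map]
    constructor
    · rintro ⟨z, hz, rfl⟩; rwa [LinearEquiv.coe_toLinearMap, grpAlgStar_grpAlgStar]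
    · intro hy; exact ⟨_, hy, by rw [LinearEquiv.coe_toLinearMap, grpAlgStar_grpAlgStar]⟩
  have hN'stab : ∀ r, ∀ y ∈ N', y * jucysMurphy k r ∈ N' := by
    intro r y hy
    rw [hmem] at hy ⊢
    rw [grpAlgStar_mul, grpAlgStar_jucysMurphy]
    exact hN r _ hy
  have hx' : ∀ r, grpAlgStar k x * jucysMurphy k r - χ r • grpAlgStar k x ∈ N' := by
    intro r
    rw [hmem, map_sub, map_smul, grpAlgStar_mul, grpAlgStar_jucysMurphy, grpAlgStar_grpAlgStar]
    exact hx r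
  refine ⟨?_, fun hχ χ' hne => ?_⟩
  · have h1 := mul_klrIdempotent_sub_mem hN'stab hx'
    rw [hmem, map_sub, grpAlgStar_mul, grpAlgStar_klrIdempotent, grpAlgStar_grpAlgStar] at h1
    exact h1
  · have := mul_klrIdempotent_mem_of_ne hN'stab hχ hx' hne
    rw [hmem, grpAlgStar_mul, grpAlgStar_klrIdempotent, grpAlgStar_grpAlgStar] at this
    exact this

/-- The residue sequence of a standard tableau is a candidate residue sequence (the cell of the
entry `r` has row and column `≤ r`). [folklore] -/
theorem residueSeq_mem_residueSeqs (p : ℕ) [Fact p.Prime] {Y : YoungDiagram} (hn : Y.cells.card = n) (T : StdFilling n Y) :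
    residueSeq p T ∈ residueSeqs (ZMod p) n := by
  rw [residueSeqs, Fintype.mem_piFinset]
  intro r
  rw [residueSeq_apply, Finset.mem_image]
  -- row and column of the entry `r` are at most `r`: the shape of the entries `≤ r` is a lower
  -- set with `r + 1` cells containing the cell of `r`
  have hlow := isCellLowerSet_prefixCells hn T r
  have hmemr : T.1 r ∈ prefixCells T.1 r := Finset.mem_image.2 ⟨r, Finset.mem_filter.2 ⟨Finset.mem_univ _, le_rfl⟩, rfl⟩
  have hcard : (prefixCells T.1 r).card ≤ r + 1 := by
    rw [prefixCells]
    refine Finset.card_image_le.trans ?_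
    rw [show (Finset.univ.filter fun j : Fin n => j ≤ r) = Finset.Iic r by ext j; simp, Fin.card_Iic]
  have hrow : (T.1 r).1 ≤ r := by
    have hsub : (Finset.range ((T.1 r).1 + 1)).image (fun a' => (a', (T.1 r).2)) ⊆ prefixCells T.1 r := by
      intro x hx
      obtain ⟨a', ha', rfl⟩ := Finset.mem_image.1 hx
      exact hlow hmemr (by have := Finset.mem_range.1 ha'; simp only; omega) le_rfl
    have h := (Finset.card_le_card hsub).trans hcard
    rw [Finset.card_image_of_injective _ (fun x y h => by simpa using h), Finset.card_range] at h
    omega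
  have hcol : (T.1 r).2 ≤ r := by
    have hsub : (Finset.range ((T.1 r).2 + 1)).image (fun b' => ((T.1 r).1, b')) ⊆ prefixCells T.1 r := by
      intro x hx
      obtain ⟨b', hb', rfl⟩ := Finset.mem_image.1 hx
      exact hlow hmemr le_rfl (by have := Finset.mem_range.1 hb'; simp only; omega)
    have h := (Finset.card_le_card hsub).trans hcard
    rw [Finset.card_image_of_injective _ (fun x y h => by simpa using h), Finset.card_range] at h
    omega
  refine ⟨((T.1 r).2 : ℤ) - (T.1 r).1, Finset.mem_Icc.2 ⟨by omega, by omega⟩, ?_⟩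
  rw [cellResidue]
  push_cast
  ring

end WeightPoly


/-! ### Jucys–Murphy triangularity on Murphy's basis (Murphy; Hu–Mathas (3.7) at level one) -/

section JMTriangular

variable {R} {n : ℕ}

/-- Relabelling `r ↔ r+1` does not move an entry across a prefix containing both or neither. [folklore] -/
theorem val_swap_lt_iff {r r' : Fin n} {k : ℕ} (hk : ((r : ℕ) < k ↔ (r' : ℕ) < k)) (e : Fin n) :
    ((swap r r' e : Fin n) : ℕ) < k ↔ (e : ℕ) < k := by
  rcases eq_or_ne e r with rfl | h1
  · rw [swap_apply_left]; exact hk.symm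
  rcases eq_or_ne e r' with rfl | h2
  · rw [swap_apply_right]; exact hk
  rw [swap_apply_of_ne_of_ne h1 h2]

/-- The prefix counts of `f ∘ s_r` and `f` agree at every prefix containing both or neither of
`r, r+1`. [folklore] -/
theorem rowCount_comp_swap (f : Fin n → ℕ × ℕ) {r r' : Fin n} {k : ℕ} (hk : ((r : ℕ) < k ↔ (r' : ℕ) < k)) (i : ℕ) :
    rowCount (f ∘ ⇑(swap r r')) k i = rowCount f k i := by
  unfold rowCount
  refine Finset.card_bij (fun e _ => swap r r' e) (fun e he => ?_)
    (fun e₁ _ e₂ _ heq => (swap r r').injective heq) (fun e he => ⟨swap r r' e, ?_, swap_apply_self _ _ _⟩)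
  · rw [Finset.mem_filter] at he ⊢
    exact ⟨Finset.mem_univ _, (val_swap_lt_iff hk e).2 he.2.1, he.2.2⟩
  · rw [Finset.mem_filter] at he ⊢
    refine ⟨Finset.mem_univ _, ?_, ?_⟩
    · exact (val_swap_lt_iff hk (swap r r' e)).1 (by rw [swap_apply_self]; exact he.2.1)
    · show (f (swap r r' (swap r r' e))).1 ≤ i
      rw [swap_apply_self]; exact he.2.2

/-- **Dominance lifts along an admissible step** (the fact behind Hu–Mathas' use of BKW Lemma 3.7):
if `f ⊵ g` and `r` lies in a strictly higher row of `g` than `r+1`, then `f ∘ s_r ⊵ g ∘ s_r`.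
[folklore] -/
theorem fillingDominates_comp_swap {f g : Fin n → ℕ × ℕ} {r r' : Fin n} (h : (r' : ℕ) = r + 1)
    (hfg : FillingDominates f g) (hrow : (g r).1 < (g r').1) :
    FillingDominates (f ∘ ⇑(swap r r')) (g ∘ ⇑(swap r r')) := by
  intro k i
  by_cases hk : ((r : ℕ) < k ↔ (r' : ℕ) < k)
  · rw [rowCount_comp_swap f hk, rowCount_comp_swap g hk]; exact hfg k i
  · have hk' : k = r + 1 := by omega
    subst hk'
    have A := hfg r i
    have B := hfg (r' + 1) i
    rw [rowCount_succ f r', rowCount_succ g r', h, rowCount_succ f r, rowCount_succ g r] at B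
    rw [rowCount_succ (f ∘ ⇑(swap r r')) r, rowCount_succ (g ∘ ⇑(swap r r')) r,
      rowCount_comp_swap f (k := r) (by omega), rowCount_comp_swap g (k := r) (by omega)]
    simp only [Function.comp_apply, swap_apply_left]
    have := hrow.le
    split_ifs at B ⊢ <;> omega

/-- Dominance through `toFill` of the rows is dominance. [folklore] -/
theorem fillingDominates_toFill_iff (f g : Fin n → ℕ × ℕ) :
    FillingDominates (toFill fun e => (f e).1) (toFill fun e => (g e).1) ↔ FillingDominates f g := by
  have hf : ∀ k i, rowCount (toFill fun e => (f e).1) k i = rowCount f k i := fun k i => rowCount_congr (fun _ => rfl) k i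
  have hg : ∀ k i, rowCount (toFill fun e => (g e).1) k i = rowCount g k i := fun k i => rowCount_congr (fun _ => rfl) k i
  simp only [FillingDominates, hf, hg]

variable {μ : Nat.Partition n}

/-- **Strict dominance `𝔲 ▷ 𝔳` of standard `λ`-tableaux** (every prefix of `𝔲` dominates the same
prefix of `𝔳`, and `𝔲 ≠ 𝔳`). [folklore] -/
def StdSDom (u v : StdFilling n μ.youngDiagram) : Prop := FillingDominates u.1 v.1 ∧ u ≠ v

/-- A strictly dominated tableau does not dominate back (a standard tableau is determined by its
rows). [folklore] -/
theorem StdSDom.not_dom {u v : StdFilling n μ.youngDiagram} (h : StdSDom u v) : ¬ FillingDominates v.1 u.1 :=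
  fun h' => h.2 (StdFilling.ext_of_row_eq μ.card_cells_youngDiagram fun e => h.1.row_eq h' e)

/-- Strict dominance is irreflexive. [folklore] -/
theorem stdSDom_irrefl (v : StdFilling n μ.youngDiagram) : ¬ StdSDom v v := fun h => h.2 rfl

/-- Strict-then-weak dominance is strict. [folklore] -/
theorem StdSDom.trans_dom {u v w : StdFilling n μ.youngDiagram} (h₁ : StdSDom u v) (h₂ : FillingDominates v.1 w.1) :
    StdSDom u w :=
  ⟨h₁.1.trans h₂, fun he => h₁.not_dom (by subst he; exact h₂)⟩

/-- Weak-then-strict dominance is strict. [folklore] -/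
theorem StdSDom.of_dom_of_sdom {u v w : StdFilling n μ.youngDiagram} (h₁ : FillingDominates u.1 v.1) (h₂ : StdSDom v w) :
    StdSDom u w :=
  ⟨h₁.trans h₂.1, fun he => h₂.not_dom (by subst he; exact h₁)⟩

/-- An admissible step `𝔳 → 𝔳' = 𝔳 ∘ s_r` (`r` strictly above `r+1` in `𝔳`) goes strictly down:
`𝔳 ▷ 𝔳'`. [folklore] -/
theorem stdSDom_of_comp_swap {v v' : StdFilling n μ.youngDiagram} {r r' : Fin n} (h : (r' : ℕ) = r + 1)
    (hv' : v'.1 = v.1 ∘ ⇑(swap r r')) (hrow : (v.1 r).1 < (v.1 r').1) : StdSDom v v' := by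
  have hlt : r < r' := by rw [Fin.lt_def]; omega
  refine ⟨?_, fun he => ?_⟩
  · refine fillingDominates_of_exchange hlt ?_ ?_ ?_ ?_
    · rw [hv', Function.comp_apply, Function.comp_apply, swap_apply_left, swap_apply_right]; exact hrow
    · rw [hv', Function.comp_apply, swap_apply_right]
    · rw [hv', Function.comp_apply, swap_apply_left]
    · intro e h1 h2; rw [hv', Function.comp_apply, swap_apply_of_ne_of_ne h1 h2]
  · have := congrFun (congrArg Subtype.val he) r
    rw [hv', Function.comp_apply, swap_apply_left] at this
    exact absurd (congrArg Prod.fst this) hrow.ne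

variable (R)

/-- **`U⁺(𝔳) = ∑_{𝔲 ▷ 𝔳} R m_{𝔲𝔱^λ}`**, the span of the row-tabloid elements of the standard tableaux
strictly dominating `𝔳`. [folklore] -/
def upperSpan (v : StdFilling n μ.youngDiagram) : Submodule R (MonoidAlgebra R (Perm (Fin n))) :=
  Submodule.span R {x | ∃ u : StdFilling n μ.youngDiagram, StdSDom u v ∧ x = murphy R u (rowReading μ)}

/-- The generators of `U⁺(𝔳)`. [folklore] -/
theorem murphy_mem_upperSpan {u v : StdFilling n μ.youngDiagram} (h : StdSDom u v) :
    murphy R u (rowReading μ) ∈ upperSpan R v :=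
  Submodule.subset_span ⟨u, h, rfl⟩

/-- `U⁺` grows down the dominance order. [folklore] -/
theorem upperSpan_mono {v w : StdFilling n μ.youngDiagram} (h : FillingDominates v.1 w.1) : upperSpan R v ≤ upperSpan R w :=
  Submodule.span_mono (by rintro x ⟨u, hu, rfl⟩; exact ⟨u, hu.trans_dom h, rfl⟩)

/-- `U⁺(𝔳) ⊆ U⁺(𝔴)` for `𝔳 ▷ 𝔴`. [folklore] -/
theorem upperSpan_le_of_sdom {v w : StdFilling n μ.youngDiagram} (h : StdSDom v w) : upperSpan R v ≤ upperSpan R w :=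
  upperSpan_mono R h.1

/-- A `stdSpan` lands in `U⁺(𝔳)` when all its standard tableaux strictly dominate `𝔳`. [folklore] -/
theorem stdSpan_le_upperSpan {ρ : Fin n → ℕ} {v : StdFilling n μ.youngDiagram}
    (h : ∀ u : StdFilling n μ.youngDiagram, FillingDominates (toFill fun e => (u.1 e).1) (toFill ρ) → StdSDom u v) :
    stdSpan R μ ρ ≤ upperSpan R v :=
  Submodule.span_mono (by rintro x ⟨u, hu, rfl⟩; exact ⟨u, h u hu, rfl⟩)

variable {R} in
/-- `w_{𝔳'} = s_r w_𝔳` for `𝔳' = 𝔳 ∘ s_r`. [folklore] -/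
theorem wordPerm_of_comp_swap {v v' : StdFilling n μ.youngDiagram} {r r' : Fin n} (hv' : v'.1 = v.1 ∘ ⇑(swap r r')) :
    wordPerm v' = swap r r' * wordPerm v := by
  rw [wordPerm_eq_iff]
  intro j
  rw [hv', Perm.mul_apply, Function.comp_apply, swap_apply_self, apply_wordPerm]

/-- `m_{𝔳'𝔱^λ} = s_r m_{𝔳𝔱^λ}` for `𝔳' = 𝔳 ∘ s_r`. [folklore] -/
theorem murphy_rowReading_of_comp_swap {v v' : StdFilling n μ.youngDiagram} {r r' : Fin n} (hv' : v'.1 = v.1 ∘ ⇑(swap r r')) :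
    murphy R v' (rowReading μ) = MonoidAlgebra.of R _ (swap r r') * murphy R v (rowReading μ) := by
  simp only [murphy, wordPerm_of_comp_swap hv', map_mul, mul_assoc]

/-- `m_{𝔲𝔳} = m_{𝔲𝔱^λ} w_𝔳⁻¹`. [folklore] -/
theorem murphy_eq_murphy_rowReading_mul (u v : StdFilling n μ.youngDiagram) :
    murphy R u v = murphy R u (rowReading μ) * MonoidAlgebra.of R _ (wordPerm v)⁻¹ := by
  rw [murphy, murphy, wordPerm_rowReading, inv_one, map_one, mul_one]

/-- **`s_r U⁺(𝔳) ⊆ U⁺(𝔳 ∘ s_r) + J^{▷λ}` along an admissible step** (straightening plus the lifting of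
dominance; the standard tableau equal to `𝔳 ∘ s_r` cannot occur, as its preimage would be `𝔳`).
[folklore] -/
theorem of_swap_mul_mem_upperSpan_sup {v v' : StdFilling n μ.youngDiagram} {r r' : Fin n} (h : (r' : ℕ) = r + 1)
    (hv' : v'.1 = v.1 ∘ ⇑(swap r r')) (hrow : (v.1 r).1 < (v.1 r').1) {x : MonoidAlgebra R (Perm (Fin n))}
    (hx : x ∈ upperSpan R v) :
    MonoidAlgebra.of R _ (swap r r') * x ∈ upperSpan R v' ⊔ domIdeal R μ.rowOf := by
  induction hx using Submodule.span_induction with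
  | mem x hx =>
    obtain ⟨u, hu, rfl⟩ := hx
    rw [murphy, wordPerm_rowReading, inv_one, map_one, mul_one, ← mul_assoc, ← map_mul]
    have key := of_mul_murphyX_mem_stdSpan_sup R μ (swap r r' * wordPerm u)
    rw [rowFunOf_mul, swap_inv, rowFunOf_wordPerm] at key
    have hlift : FillingDominates (toFill ((fun e => (u.1 e).1) ∘ ⇑(swap r r'))) (toFill fun e => (v'.1 e).1) := by
      have h1 := (fillingDominates_toFill_iff _ _).2 (fillingDominates_comp_swap h hu.1 hrow)
      rw [← hv'] at h1
      exact h1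
    refine (sup_le_sup_right (stdSpan_le_upperSpan R fun u'' hu'' => ?_) _) key
    refine ⟨(fillingDominates_toFill_iff _ _).1 (hu''.trans hlift), fun he => hu.2 ?_⟩
    rw [he] at hu''
    refine StdFilling.ext_of_row_eq μ.card_cells_youngDiagram fun e => ?_
    have hrows := hlift.row_eq hu'' (swap r r' e)
    simp only [toFill_fst, Function.comp_apply, swap_apply_self] at hrows
    rw [hrows, hv', Function.comp_apply, swap_apply_self]
  | zero => rw [mul_zero]; exact Submodule.zero_mem _
  | add x y _ _ hx hy => rw [mul_add]; exact Submodule.add_mem _ hx hy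
  | smul c x _ hx => rw [mul_smul_comm]; exact Submodule.smul_mem _ c hx

/-- `s_r (U⁺(𝔳) + J^{▷λ}) ⊆ U⁺(𝔳 ∘ s_r) + J^{▷λ}`. [folklore] -/
theorem of_swap_mul_mem_upperSpan_sup' {v v' : StdFilling n μ.youngDiagram} {r r' : Fin n} (h : (r' : ℕ) = r + 1)
    (hv' : v'.1 = v.1 ∘ ⇑(swap r r')) (hrow : (v.1 r).1 < (v.1 r').1) {x : MonoidAlgebra R (Perm (Fin n))}
    (hx : x ∈ upperSpan R v ⊔ domIdeal R μ.rowOf) :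
    MonoidAlgebra.of R _ (swap r r') * x ∈ upperSpan R v' ⊔ domIdeal R μ.rowOf := by
  obtain ⟨a, ha, b, hb, rfl⟩ := Submodule.mem_sup.1 hx
  rw [mul_add]
  exact Submodule.add_mem _ (of_swap_mul_mem_upperSpan_sup R h hv' hrow ha)
    (Submodule.mem_sup_right (of_mul_mem_domIdeal R _ hb))

/-- **The content `c_𝔳(k) = col - row` of the entry `k` of `𝔳`**, in `R`. [folklore] -/
def jmContent {Y : YoungDiagram} (v : StdFilling n Y) (k : Fin n) : R := ((v.1 k).2 : R) - ((v.1 k).1 : R)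

/-- `L_r* = L_r` (any commutative ring; cf. `grpAlgStar_jucysMurphy`). [folklore] -/
theorem grpAlgStar_jucysMurphy_comm (r : Fin n) : grpAlgStar R (jucysMurphy R r) = jucysMurphy R r := by
  rw [jucysMurphy, map_sum]
  exact Finset.sum_congr rfl fun j _ => by rw [grpAlgStar_of, swap_inv]

/-- **The base case, left-handed: `L_k x_λ ≡ (c - r) x_λ (mod J^{▷λ})`** (`*` of
`murphyX_mul_jucysMurphy_sub_smul_mem`). [cite: HuMathas2010, §3.3 (3.7)] -/
theorem jucysMurphy_mul_murphyX_sub_smul_mem (μ : Nat.Partition n) (k : Fin n) :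
    jucysMurphy R k * murphyX R μ - ((μ.colOf k : R) - (μ.rowOf k : R)) • murphyX R μ ∈ domIdeal R μ.rowOf := by
  have h := grpAlgStar_mem_domIdeal R (murphyX_mul_jucysMurphy_sub_smul_mem R μ k)
  rw [map_sub, map_smul, grpAlgStar_mul, grpAlgStar_jucysMurphy_comm, grpAlgStar_murphyX] at h
  exact h

/-- **The inductive step of the Jucys–Murphy triangularity** along an admissible step
`𝔳 → 𝔳' = 𝔳 ∘ s_r`: `m_{𝔳'𝔱^λ} = s_r m_{𝔳𝔱^λ}`, and `L_k s_r = s_r L_{s_r k} ± [k ∈ {r, r+1}]`,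
the correction `∓ m_{𝔳𝔱^λ}` lying in `U⁺(𝔳')` as `𝔳 ▷ 𝔳'`. [cite: HuMathas2010, §3.3 (3.7)] -/
theorem jmTri_step {v v' : StdFilling n μ.youngDiagram} {r r' : Fin n} (h : (r' : ℕ) = r + 1)
    (hv' : v'.1 = v.1 ∘ ⇑(swap r r')) (hrow : (v.1 r).1 < (v.1 r').1)
    (IH : ∀ k, jucysMurphy R k * murphy R v (rowReading μ) - jmContent R v k • murphy R v (rowReading μ) ∈
      upperSpan R v ⊔ domIdeal R μ.rowOf) (k : Fin n) :
    jucysMurphy R k * murphy R v' (rowReading μ) - jmContent R v' k • murphy R v' (rowReading μ) ∈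
      upperSpan R v' ⊔ domIdeal R μ.rowOf := by
  have hT : ∀ x ∈ upperSpan R v ⊔ domIdeal R μ.rowOf,
      MonoidAlgebra.of R _ (swap r r') * x ∈ upperSpan R v' ⊔ domIdeal R μ.rowOf :=
    fun x hx => of_swap_mul_mem_upperSpan_sup' R h hv' hrow hx
  have hfv : murphy R v (rowReading μ) ∈ upperSpan R v' ⊔ domIdeal R μ.rowOf :=
    Submodule.mem_sup_left (murphy_mem_upperSpan R (stdSDom_of_comp_swap h hv' hrow))
  set f := murphy R v (rowReading μ) with hf
  rw [murphy_rowReading_of_comp_swap R hv']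
  rcases eq_or_ne k r with hkr | hkr
  · -- `k = r`: `L_r s_r = s_r L_{r+1} - 1`, and `c_{𝔳'}(r) = c_𝔳(r+1)`
    rw [hkr]
    have e1 : jucysMurphy R r * (MonoidAlgebra.of R _ (swap r r') * f) =
        MonoidAlgebra.of R _ (swap r r') * (jucysMurphy R r' * f) - f := by
      rw [← mul_assoc, show jucysMurphy R r * MonoidAlgebra.of R _ (swap r r') =
          MonoidAlgebra.of R _ (swap r r') * jucysMurphy R r' - 1 from
        eq_sub_of_add_eq (of_swap_mul_jucysMurphy_succ R h).symm, sub_mul, one_mul, mul_assoc]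
    have hc : jmContent R v' r = jmContent R v r' := by
      simp only [jmContent, hv', Function.comp_apply, swap_apply_left]
    rw [e1, hc]
    have := hT _ (IH r')
    rw [mul_sub, mul_smul_comm] at this
    convert Submodule.sub_mem _ this hfv using 1
    abel
  rcases eq_or_ne k r' with hkr' | hkr'
  · -- `k = r+1`: `L_{r+1} s_r = s_r L_r + 1`, and `c_{𝔳'}(r+1) = c_𝔳(r)`
    rw [hkr']
    have e1 : jucysMurphy R r' * (MonoidAlgebra.of R _ (swap r r') * f) =
        MonoidAlgebra.of R _ (swap r r') * (jucysMurphy R r * f) + f := by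
      rw [← mul_assoc, jucysMurphy_succ_mul_swap R h, add_mul, one_mul, mul_assoc]
    have hc : jmContent R v' r' = jmContent R v r := by
      simp only [jmContent, hv', Function.comp_apply, swap_apply_right]
    rw [e1, hc]
    have := hT _ (IH r)
    rw [mul_sub, mul_smul_comm] at this
    convert Submodule.add_mem _ this hfv using 1
    abel
  · -- `k ∉ {r, r+1}`: `L_k s_r = s_r L_k`
    have e1 : jucysMurphy R k * (MonoidAlgebra.of R _ (swap r r') * f) =
        MonoidAlgebra.of R _ (swap r r') * (jucysMurphy R k * f) := by
      rw [← mul_assoc, ← of_swap_mul_jucysMurphy_of_ne R h hkr hkr', mul_assoc]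
    have hc : jmContent R v' k = jmContent R v k := by
      simp only [jmContent, hv', Function.comp_apply, swap_apply_of_ne_of_ne hkr hkr']
    rw [e1, hc]
    have := hT _ (IH k)
    rwa [mul_sub, mul_smul_comm] at this

/-- **Jucys–Murphy triangularity of Murphy's basis (Murphy; Dipper–James; Hu–Mathas 2010, (3.7),
at level one, left-handed form): `L_k m_{𝔳𝔱^λ} ≡ c_𝔳(k) m_{𝔳𝔱^λ} + ∑_{𝔲 ▷ 𝔳} a_𝔲 m_{𝔲𝔱^λ}
(mod J^{▷λ})`**, `c_𝔳(k)` the content of the cell of `k` in `𝔳` — by induction along an admissible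
chain from `𝔱^λ` (`exists_admissible_chain`), starting from `L_k x_λ ≡ (c - r) x_λ`.
[cite: HuMathas2010, §3.3 (3.7)] -/
theorem jucysMurphy_mul_murphy_sub_smul_mem (v : StdFilling n μ.youngDiagram) (k : Fin n) :
    jucysMurphy R k * murphy R v (rowReading μ) - jmContent R v k • murphy R v (rowReading μ) ∈
      upperSpan R v ⊔ domIdeal R μ.rowOf := by
  obtain ⟨m, Ts, rs, rs', hTm, h0, -, hstep⟩ := exists_admissible_chain v
  have hT0 : Ts 0 = rowReading μ := eq_rowReading_of_rowInv_eq_zero _ h0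
  suffices H : ∀ j, j ≤ m → ∀ k, jucysMurphy R k * murphy R (Ts j) (rowReading μ) -
      jmContent R (Ts j) k • murphy R (Ts j) (rowReading μ) ∈ upperSpan R (Ts j) ⊔ domIdeal R μ.rowOf by
    rw [← hTm]; exact H m le_rfl k
  intro j
  induction j with
  | zero =>
    intro _ k
    rw [hT0, murphy_rowReading]
    exact Submodule.mem_sup_right (jucysMurphy_mul_murphyX_sub_smul_mem R μ k)
  | succ j ih =>
    intro hj k
    obtain ⟨h, hcomp, hrow, -⟩ := hstep ⟨j, by omega⟩
    exact jmTri_step R h hcomp hrow (ih (by omega)) k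

/-- **Two-sided form: `L_k m_{𝔲𝔳} ≡ c_𝔲(k) m_{𝔲𝔳} + ∑_{𝔲'' ▷ 𝔲} a m_{𝔲''𝔳} (mod J^{▷λ})`.**
[cite: HuMathas2010, §3.3 (3.7)] -/
theorem jucysMurphy_mul_murphy_sub_smul_mem' (u v : StdFilling n μ.youngDiagram) (k : Fin n) :
    jucysMurphy R k * murphy R u v - jmContent R u k • murphy R u v ∈
      (upperSpan R u).map (LinearMap.mulRight R (MonoidAlgebra.of R _ (wordPerm v)⁻¹)) ⊔ domIdeal R μ.rowOf := by
  obtain ⟨a, ha, b, hb, hab⟩ := Submodule.mem_sup.1 (jucysMurphy_mul_murphy_sub_smul_mem R u k)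
  rw [murphy_eq_murphy_rowReading_mul R u v, ← mul_assoc, ← smul_mul_assoc, ← sub_mul, ← hab, add_mul]
  exact Submodule.add_mem _ (Submodule.mem_sup_left ⟨a, ha, rfl⟩) (Submodule.mem_sup_right (mul_of_mem_domIdeal R _ hb))

/-- **`U⁺(𝔳) + J^{▷λ}` is stable under the `L_k`** (each `m_{𝔲𝔱^λ}`, `𝔲 ▷ 𝔳`, goes to
`c m_{𝔲𝔱^λ} + U⁺(𝔲) + J ⊆ U⁺(𝔳) + J`). [folklore] -/
theorem jucysMurphy_mul_mem_upperSpan_sup (v : StdFilling n μ.youngDiagram) (k : Fin n)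
    {x : MonoidAlgebra R (Perm (Fin n))} (hx : x ∈ upperSpan R v ⊔ domIdeal R μ.rowOf) :
    jucysMurphy R k * x ∈ upperSpan R v ⊔ domIdeal R μ.rowOf := by
  obtain ⟨a, ha, b, hb, rfl⟩ := Submodule.mem_sup.1 hx
  rw [mul_add]
  refine Submodule.add_mem _ ?_ (Submodule.mem_sup_right (mul_mem_domIdeal_left R _ hb))
  clear hx
  induction ha using Submodule.span_induction with
  | mem x hx =>
    obtain ⟨u, hu, rfl⟩ := hx
    have key := jucysMurphy_mul_murphy_sub_smul_mem R u k
    rw [show jucysMurphy R k * murphy R u (rowReading μ) = (jucysMurphy R k * murphy R u (rowReading μ) -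
        jmContent R u k • murphy R u (rowReading μ)) + jmContent R u k • murphy R u (rowReading μ) by rw [sub_add_cancel]]
    exact Submodule.add_mem _ ((sup_le_sup_right (upperSpan_le_of_sdom R hu) _) key)
      (Submodule.mem_sup_left (Submodule.smul_mem _ _ (murphy_mem_upperSpan R hu)))
  | zero => rw [mul_zero]; exact Submodule.zero_mem _
  | add x y _ _ hx hy => rw [mul_add]; exact Submodule.add_mem _ hx hy
  | smul c x _ hx => rw [mul_smul_comm]; exact Submodule.smul_mem _ c hx

end JMTriangular






end Literature.RepresentationTheory.FiniteGroups
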